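import Literature.MathematicalPhysics.StatisticalMechanics.Theil2006DiscreteImbedding
import Mathlib.Analysis.Convex.Join
import Mathlib.Analysis.Convex.Topology
import Mathlib.Analysis.Normed.Affine.Convex
import Mathlib.MeasureTheory.Measure.Lebesgue.EqHaar
import Mathlib.MeasureTheory.Measure.Haar.InnerProductSpace
import HarnessLib

/-!
# Theil 2006, Appendix: the triangle cover (63) of defect-free regions, local planarity of the
bond graph, and the partition of long simplices by unit simplices (proof of Prop. 2.9 (27)) —
proofs

Topic `Literature/MathematicalPhysics/StatisticalMechanics`; companion of `Theil2006.lean`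
(F. Theil, *A proof of crystallization in two dimensions*, Comm. Math. Phys. **262** (2006)
209–236, accepted preprint of 26 Aug 2005, lit store `paper:url-69bff4ce1e30`), Appendix §4.2,
proof of Proposition 4.8, display (63) (preprint p. 21). PROVED, from the tree's Lemma 4.7
(`Theil2006DiscreteImbedding.lean`: `exists_ccwNbhd`, `CcwNbhd.det₂_pos`,
`CcwNbhd.isShortRange_succ`, `exists_isHexagonalNbhd`).

## Source, as printed (preprint p. 21)

"Let `Ω₂ = {η ∈ Ω | dist(η, ∂Ω) ≥ 2}`. We first demonstrate that for almost every `η ∈ Ω₂` there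
exists a small simplex `T ∈ 𝒯₁` such that `η ∈ int(conv(y(T)))`. It can be assumed wlog that
there exists `x₀ ∈ y⁻¹(Ω₂)`, otherwise the assertion is trivial. Let
`λ = {s ∈ [0, 1] | (1 − s)y(x₀) + sη ∈ ∪_{T∈𝒯₁} conv(y(T))}`.
We will show now that `λ` is both closed and open relatively to the closed unit interval
`[0, 1] ⊂ ℝ`. `λ` is closed as it arises as a finite intersection of closed sets. Let
`s₀ ∈ ∂λ ∩ (0, 1)`. By construction there exists `T₀ ∈ 𝒯₁` such that `y(T₀) ⊂ Ω` and
`ξ = (1 − s₀)y(x₀) + s₀η ∈ ∂conv(y(T₀))`. Consequentially we can find `σ ∈ [0, 1]` and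
`x₁, x₂ ∈ T₀` such that `ξ = σy(x₁) + (1 − σ)y(x₂)`. The measure of set of those points `η ∈ ℝ²`
with the property that `σ = 0` or `σ = 1` is zero, therefore we can neglect the extreme cases and
assume that `σ ∈ (0, 1)`. By Lemma 4.7 there exists `ε > 0` such that for all
`s ∈ (s₀ − ε, s₀ + ε)` we have that `(1−s)y(x₀) + sη ∈ ∪_{T∈𝒯₁} conv(y(T))`, which is a
contradiction to the assumption that `s₀ ∈ ∂λ ∩ (0, 1)`. Since `λ` is nonempty this implies that
`λ = [0, 1]` and in particular
(63) `Ω₂ ⊂ ⋃_{T ∈ 𝒯₁} conv(y(T))`."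
(Here `Ω` is convex with `Ω ∩ y(∂X) = ∅`, hypotheses of Proposition 4.8.)

## What is proved

`Theil2006.exists_simplex_mem_convexHull_of_mem_ball` / `Theil2006.ball_subset_biUnion_convexHull`:
under (13) with `0 < α ≤ 1/200` and finitely many particles, for `Ω = B(c, R)` free of defects
and `r + 2 ≤ R`: if some particle lies in `B(c, r)`, then
`B(c, r) ⊆ ⋃ {conv(y(T)) : T ∈ 𝒯₁(y), y(T) ⊂ B(c, R)}` — (63) for balls, with the print's
margin `2`, and WITHOUT the "almost every"/"neglect the extreme cases" proviso: the vertex case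
`σ ∈ {0, 1}` is covered too (around a vertex the six wheel triangles of Lemma 4.7 cover a ball,
`exists_cover_nhds_vertex`).  The continuity argument is run on the connected ball itself rather
than on segments: the covered part is relatively closed (finitely many compact triangles) and
relatively open (`exists_cover_nhds`: interior points — non-degeneracy of `𝒮`-triangles,
`sq_le_det₂_sq_of_isShortRange`; edge points — the two triangles through the edge given by the
counter-clockwise successors of Lemma 4.7 on either side, `exists_cover_nhds_edge`; vertices).
The planar lemmas (Cramer coefficients, their Lipschitz dependence, the sector count around a
vertex) are elementary and private.  Corollary for the (27)-bookkeeping (Appendix p. 25):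
`IsEquilateralSimplex.convexHull_subset_biUnion` — a long simplex `T ∈ 𝒯_λ(y)` (`λ > 1`) is covered
by the unit simplices with vertices in `B(z_T, 6λ + 2)`.

Local planarity (section `Planarity`; the facts implicit in Definition 4.4's bond polygon
"`∂Ω(γ) = ∪_k [y(γ(k)), y(γ(k+1))]` … Jordan's curve theorem", p. 19, and in the partition identity
of p. 25), all under (13) with `0 < α ≤ 1/200`: `segment_inter_segment_eq_empty` — two short bonds
with four distinct endpoints are disjoint segments (purely metric: a common point would put an
endpoint of one within `1 − α` of an endpoint of the other); `mem_of_mem_convexHull_triple` — a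
particle in the closed triangle of a unit simplex `{a, b, c}` (`a ∉ ∂X`) is one of `a, b, c`
(Lemma 4.7's rider at each vertex, then the wheel of `a`); `not_inOpenTri_of_inOpenTri` — two
distinct unit simplices have disjoint OPEN triangles (follow the segment from a common interior
point to a vertex of the second simplex outside the first: it leaves the first triangle through a
bond, inside the second; that bond then leaves the second triangle through one of ITS bonds —
either two crossing bonds or two bonds at one particle along one ray, both excluded by (13)).

`convexHull_inter_convexHull_subset_face` (section `Faces`) — two distinct unit simplices
with non-defective vertices meet only in a common face: `conv y(S) ∩ conv y(S′) ⊆ conv y(S ∩ S′)`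
(the unit simplices of the defect-free region form an embedded simplicial complex).

The partition (section `Partition`): `volume_convexHull_inter_convexHull_eq_zero` — distinct unit
simplices with non-defective vertices overlap in a Lebesgue-null set (the six edges);
`volume_convexHull_eq_sum_inter` / `toReal_volume_convexHull_eq_sum_inter` — **the partition
identity** "`meas(conv y(T)) = Σ_{S∈𝒯₁} meas(conv y(S) ∩ conv y(T))`" of the proof of
Proposition 2.9 (27) (p. 25, the equality marked "Lemma 2.7"), PROVED for every `T ∈ 𝒯_λ(y)`,
`λ > 1`, finitely many particles: cover by (63), null overlaps, finite additivity.  (The other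
input of that proof, (72), is NOT addressed here.)
-/

noncomputable section

namespace Literature.MathematicalPhysics.StatisticalMechanics

namespace Theil2006

open Metric Set

/-! ### Plane vectors in coordinates -/

section PlaneAlgebra

/-- The coordinate inner product on `ℝ²`. [folklore] -/
private def dotc (u v : Plane) : ℝ := u 0 * v 0 + u 1 * v 1

/-- `‖v‖² = v₀² + v₁²`. [folklore] -/
private theorem norm_sq_coords' (v : Plane) : ‖v‖ ^ 2 = v 0 ^ 2 + v 1 ^ 2 := by
  rw [EuclideanSpace.norm_sq_eq, Fin.sum_univ_two, Real.norm_eq_abs, Real.norm_eq_abs, sq_abs,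
    sq_abs]

/-- `‖u − v‖² = ‖u‖² − 2⟨u,v⟩ + ‖v‖²`. [folklore] -/
private theorem norm_sub_sq_dotc (u v : Plane) :
    ‖u - v‖ ^ 2 = ‖u‖ ^ 2 - 2 * dotc u v + ‖v‖ ^ 2 := by
  rw [norm_sq_coords', norm_sq_coords', norm_sq_coords', dotc]
  simp only [PiLp.sub_apply]
  ring

/-- Lagrange's identity `⟨u,v⟩² + det(u,v)² = ‖u‖² ‖v‖²`. [folklore] -/
private theorem dotc_sq_add_det₂_sq (u v : Plane) :
    dotc u v ^ 2 + det₂ u v ^ 2 = ‖u‖ ^ 2 * ‖v‖ ^ 2 := by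
  rw [norm_sq_coords', norm_sq_coords', dotc, det₂]
  ring

/-- `|det(u, v)| ≤ ‖u‖ ‖v‖`. [folklore] -/
private theorem abs_det₂_le (u v : Plane) : |det₂ u v| ≤ ‖u‖ * ‖v‖ := by
  have h := dotc_sq_add_det₂_sq u v
  refine abs_le_of_sq_le_sq ?_ (by positivity)
  nlinarith [sq_nonneg (dotc u v)]

/-- `det(v, u) = −det(u, v)`. [folklore] -/
private theorem det₂_swap' (u v : Plane) : det₂ v u = -det₂ u v := by
  unfold det₂; ring

/-- `det` is additive in the second slot (difference form). [folklore] -/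
private theorem det₂_sub_right (u v w : Plane) : det₂ u (v - w) = det₂ u v - det₂ u w := by
  unfold det₂
  simp only [PiLp.sub_apply]
  ring

/-- `det` is additive in the first slot (difference form). [folklore] -/
private theorem det₂_sub_left (u v w : Plane) : det₂ (u - v) w = det₂ u w - det₂ v w := by
  unfold det₂
  simp only [PiLp.sub_apply]
  ring

/-- `det(u, s u + t v) = t det(u, v)`. [folklore] -/
private theorem det₂_smul_add_smul_right (u v : Plane) (s t : ℝ) :
    det₂ u (s • u + t • v) = t * det₂ u v := by
  unfold det₂
  simp only [PiLp.add_apply, PiLp.smul_apply, smul_eq_mul]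
  ring

/-- `det(s u + t v, v) = s det(u, v)`. [folklore] -/
private theorem det₂_smul_add_smul_left (u v : Plane) (s t : ℝ) :
    det₂ (s • u + t • v) v = s * det₂ u v := by
  unfold det₂
  simp only [PiLp.add_apply, PiLp.smul_apply, smul_eq_mul]
  ring

/-- `det(B − A, Q − A) = −det(A − B, Q − B)`. [folklore] -/
private theorem det₂_flip_base (A B Q : Plane) : det₂ (B - A) (Q - A) = -det₂ (A - B) (Q - B) := by
  unfold det₂
  simp only [PiLp.sub_apply]
  ring

/-- Cramer's rule in the plane: `w = (det(w,v)/D) u + (det(u,w)/D) v`, `D = det(u,v) ≠ 0`.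
[folklore] -/
private theorem cramer₂ (u v w : Plane) (hD : det₂ u v ≠ 0) :
    w = (det₂ w v / det₂ u v) • u + (det₂ u w / det₂ u v) • v := by
  have key : det₂ u v • w = det₂ w v • u + det₂ u w • v := by
    ext i
    fin_cases i
    · simp only [PiLp.add_apply, PiLp.smul_apply, smul_eq_mul, det₂, Fin.zero_eta, Fin.isValue]
      ring
    · simp only [PiLp.add_apply, PiLp.smul_apply, smul_eq_mul, det₂, Fin.mk_one, Fin.isValue]
      ring
  calc w = (det₂ u v)⁻¹ • (det₂ u v • w) := by rw [smul_smul, inv_mul_cancel₀ hD, one_smul]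
    _ = (det₂ w v / det₂ u v) • u + (det₂ u w / det₂ u v) • v := by
      rw [key, smul_add, smul_smul, smul_smul, div_eq_inv_mul, div_eq_inv_mul]

/-- The frame identity behind the direction count:
`det(u, u′) ‖d‖² = ⟨u, d⟩ det(d, u′) − ⟨u′, d⟩ det(d, u)`. [folklore] -/
private theorem det₂_mul_norm_sq (u u' d : Plane) :
    det₂ u u' * (d 0 ^ 2 + d 1 ^ 2) = dotc u d * det₂ d u' - dotc u' d * det₂ d u := by
  unfold det₂ dotc
  ring

/-- A nonzero plane vector has `d₀² + d₁² > 0`. [folklore] -/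
private theorem coords_sq_pos {d : Plane} (hd : d ≠ 0) : 0 < d 0 ^ 2 + d 1 ^ 2 := by
  rw [← norm_sq_coords']
  exact pow_pos (norm_pos_iff.2 hd) 2

/-- No real sequence on `ℤ/6` decreases strictly at every step. [folklore] -/
private theorem fin6_no_strict_cycle {c : Fin 6 → ℝ} (h : ∀ i, c (i + 1) < c i) : False := by
  have h0 := h 0
  have h1 := h 1
  have h2 := h 2
  have h3 := h 3
  have h4 := h 4
  have h5 := h 5
  have e0 : (0 : Fin 6) + 1 = 1 := by decide
  have e1 : (1 : Fin 6) + 1 = 2 := by decide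
  have e2 : (2 : Fin 6) + 1 = 3 := by decide
  have e3 : (3 : Fin 6) + 1 = 4 := by decide
  have e4 : (4 : Fin 6) + 1 = 5 := by decide
  have e5 : (5 : Fin 6) + 1 = 0 := by decide
  rw [e0] at h0; rw [e1] at h1; rw [e2] at h2; rw [e3] at h3; rw [e4] at h4; rw [e5] at h5
  linarith

/-- **Direction count.** If six vectors `u₀, …, u₅` (indices mod 6) satisfy
`det(u_i, u_{i+1}) > 0` for all `i`, then every vector `d` lies in one of the closed angular
sectors: `det(u_i, d) ≥ 0` and `det(d, u_{i+1}) ≥ 0` for some `i`. [folklore] -/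
private theorem exists_sector (u : Fin 6 → Plane) (hdet : ∀ i, 0 < det₂ (u i) (u (i + 1)))
    (d : Plane) : ∃ i, 0 ≤ det₂ (u i) d ∧ 0 ≤ det₂ d (u (i + 1)) := by
  by_cases hd : d = 0
  · refine ⟨0, ?_, ?_⟩ <;> simp [hd, det₂]
  by_contra hcon
  push Not at hcon
  -- `β j = det(d, u_j)`; no sector means: `β_i ≤ 0 → β_{i+1} < 0`
  have step : ∀ i, det₂ d (u i) ≤ 0 → det₂ d (u (i + 1)) < 0 := fun i hi =>
    hcon i (by rw [det₂_swap']; linarith)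
  have back : ∀ i, 0 ≤ det₂ d (u (i + 1)) → 0 < det₂ d (u i) := fun i hi => by
    by_contra h'
    exact absurd (step i (not_lt.1 h')) (not_lt.2 hi)
  have e0 : (0 : Fin 6) + 1 = 1 := by decide
  have e1 : (1 : Fin 6) + 1 = 2 := by decide
  have e2 : (2 : Fin 6) + 1 = 3 := by decide
  have e3 : (3 : Fin 6) + 1 = 4 := by decide
  have e4 : (4 : Fin 6) + 1 = 5 := by decide
  have e5 : (5 : Fin 6) + 1 = 0 := by decide
  -- all `β_j β_{j+1} > 0`
  have hprod : ∀ i, 0 < det₂ d (u i) * det₂ d (u (i + 1)) := by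
    rcases le_or_gt (det₂ d (u 0)) 0 with h0 | h0
    · have g1 := step 0 h0
      rw [e0] at g1
      have g2 := step 1 g1.le
      rw [e1] at g2
      have g3 := step 2 g2.le
      rw [e2] at g3
      have g4 := step 3 g3.le
      rw [e3] at g4
      have g5 := step 4 g4.le
      rw [e4] at g5
      have g0 := step 5 g5.le
      rw [e5] at g0
      intro i
      fin_cases i
      · simp only [Fin.zero_eta, Fin.isValue, e0]; exact mul_pos_of_neg_of_neg g0 g1
      · simp only [Fin.mk_one, Fin.isValue, e1]; exact mul_pos_of_neg_of_neg g1 g2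
      · simp only [Fin.reduceFinMk, Fin.isValue, e2]; exact mul_pos_of_neg_of_neg g2 g3
      · simp only [Fin.reduceFinMk, Fin.isValue, e3]; exact mul_pos_of_neg_of_neg g3 g4
      · simp only [Fin.reduceFinMk, Fin.isValue, e4]; exact mul_pos_of_neg_of_neg g4 g5
      · simp only [Fin.reduceFinMk, Fin.isValue, e5]; exact mul_pos_of_neg_of_neg g5 g0
    · have g5 := back 5 (by rw [e5]; exact h0.le)
      have g4 := back 4 (by rw [e4]; exact g5.le)
      have g3 := back 3 (by rw [e3]; exact g4.le)
      have g2 := back 2 (by rw [e2]; exact g3.le)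
      have g1 := back 1 (by rw [e1]; exact g2.le)
      intro i
      fin_cases i
      · simp only [Fin.zero_eta, Fin.isValue, e0]; exact mul_pos h0 g1
      · simp only [Fin.mk_one, Fin.isValue, e1]; exact mul_pos g1 g2
      · simp only [Fin.reduceFinMk, Fin.isValue, e2]; exact mul_pos g2 g3
      · simp only [Fin.reduceFinMk, Fin.isValue, e3]; exact mul_pos g3 g4
      · simp only [Fin.reduceFinMk, Fin.isValue, e4]; exact mul_pos g4 g5
      · simp only [Fin.reduceFinMk, Fin.isValue, e5]; exact mul_pos g5 h0
  -- the ratios `c_j = ⟨u_j, d⟩ / β_j` decrease strictly around the cycle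
  have hnd := coords_sq_pos hd
  refine fin6_no_strict_cycle (c := fun j => dotc (u j) d / det₂ d (u j)) fun i => ?_
  have hp := hprod i
  have hβ : det₂ d (u i) ≠ 0 := fun h => by rw [h, zero_mul] at hp; exact lt_irrefl _ hp
  have hβ' : det₂ d (u (i + 1)) ≠ 0 := fun h => by rw [h, mul_zero] at hp; exact lt_irrefl _ hp
  have hid := det₂_mul_norm_sq (u i) (u (i + 1)) d
  have hpos : 0 < dotc (u i) d * det₂ d (u (i + 1)) - dotc (u (i + 1)) d * det₂ d (u i) := by
    rw [← hid]; exact mul_pos (hdet i) hnd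
  show dotc (u (i + 1)) d / det₂ d (u (i + 1)) < dotc (u i) d / det₂ d (u i)
  rw [← sub_pos, div_sub_div _ _ hβ hβ']
  exact div_pos (by linarith) hp

/-- Perturbation of the Cramer coefficients: both are `‖·‖/|D|`-Lipschitz in the vector.
[folklore] -/
private theorem coeff_perturb (u v d d₀ : Plane) {D : ℝ} (hD : D ≠ 0) :
    |det₂ d v / D - det₂ d₀ v / D| ≤ ‖d - d₀‖ * ‖v‖ / |D| ∧
      |det₂ u d / D - det₂ u d₀ / D| ≤ ‖d - d₀‖ * ‖u‖ / |D| := by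
  have hD' : 0 < |D| := abs_pos.2 hD
  constructor
  · rw [← sub_div, ← det₂_sub_left, abs_div]
    gcongr
    exact abs_det₂_le _ _
  · rw [← sub_div, ← det₂_sub_right, abs_div]
    gcongr
    rw [det₂_swap' (d - d₀) u, abs_neg]
    exact abs_det₂_le _ _

end PlaneAlgebra

/-! ### Three local covering lemmas in the plane -/

section LocalCover

/-- A point `A + s(B − A) + t(C − A)` with `s, t ≥ 0`, `s + t ≤ 1` lies in `conv{A, B, C}`.
[folklore] -/
private theorem mem_convexHull_triple {A B C η : Plane} {s t : ℝ} (hs : 0 ≤ s) (ht : 0 ≤ t)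
    (hst : s + t ≤ 1) (hη : η = A + (s • (B - A) + t • (C - A))) :
    η ∈ convexHull ℝ ({A, B, C} : Set Plane) := by
  have hconv := convex_convexHull ℝ ({A, B, C} : Set Plane)
  have hw := hconv.sum_mem (t := Finset.univ) (w := ![1 - s - t, s, t]) (z := ![A, B, C])
    (fun i _ => by fin_cases i <;> simp <;> linarith)
    (by rw [Fin.sum_univ_three]; simp; ring)
    (fun i _ => subset_convexHull ℝ _ (by fin_cases i <;> simp))
  rw [Fin.sum_univ_three] at hw
  simp only [Fin.isValue, Matrix.cons_val_zero, Matrix.cons_val_one, Matrix.cons_val] at hw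
  convert hw using 1
  rw [hη]
  module

/-- **Interior points.** If `ξ = A + s(B − A) + t(C − A)` with `s, t > 0`, `s + t < 1` and the
triangle `A, B, C` is non-degenerate, a ball around `ξ` lies in `conv{A, B, C}`. [folklore] -/
private theorem exists_ball_subset_of_interior {A B C ξ : Plane} {s t : ℝ} (hs : 0 < s)
    (ht : 0 < t) (hst : s + t < 1) (hξ : ξ = A + (s • (B - A) + t • (C - A)))
    (hD : det₂ (B - A) (C - A) ≠ 0) :
    ∃ ε > 0, ball ξ ε ⊆ convexHull ℝ ({A, B, C} : Set Plane) := by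
  set u := B - A with hu
  set v := C - A with hv
  set M := ‖u‖ + ‖v‖ + 1 with hMdef
  set m := min (min s t) (1 - s - t) with hmdef
  have hm : 0 < m := lt_min (lt_min hs ht) (by linarith)
  have hms : m ≤ s := le_trans (min_le_left _ _) (min_le_left _ _)
  have hmt : m ≤ t := le_trans (min_le_left _ _) (min_le_right _ _)
  have hmst : m ≤ 1 - s - t := min_le_right _ _
  have hM : 0 < M := by positivity
  have hDpos : 0 < |det₂ u v| := abs_pos.2 hD
  refine ⟨m * |det₂ u v| / (2 * M), by positivity, fun η hη => ?_⟩
  rw [mem_ball, dist_eq_norm] at hη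
  have hξA : ξ - A = s • u + t • v := by rw [hξ]; abel
  have ha0 : det₂ (ξ - A) v / det₂ u v = s := by
    rw [hξA, det₂_smul_add_smul_left, mul_div_assoc, div_self hD, mul_one]
  have hb0 : det₂ u (ξ - A) / det₂ u v = t := by
    rw [hξA, det₂_smul_add_smul_right, mul_div_assoc, div_self hD, mul_one]
  obtain ⟨hpa, hpb⟩ := coeff_perturb u v (η - A) (ξ - A) hD
  rw [sub_sub_sub_cancel_right, ha0] at hpa
  rw [sub_sub_sub_cancel_right, hb0] at hpb
  have hsmall : ‖η - ξ‖ * M / |det₂ u v| < m / 2 := by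
    rw [div_lt_iff₀ hDpos]
    calc ‖η - ξ‖ * M < m * |det₂ u v| / (2 * M) * M := by gcongr
      _ = m / 2 * |det₂ u v| := by field_simp
  have h1 : ‖η - ξ‖ * ‖v‖ / |det₂ u v| < m / 2 :=
    lt_of_le_of_lt (by gcongr; linarith [norm_nonneg u, norm_nonneg v]) hsmall
  have h2 : ‖η - ξ‖ * ‖u‖ / |det₂ u v| < m / 2 :=
    lt_of_le_of_lt (by gcongr; linarith [norm_nonneg u, norm_nonneg v]) hsmall
  have ha := abs_le.1 (hpa.trans h1.le)
  have hb := abs_le.1 (hpb.trans h2.le)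
  refine mem_convexHull_triple (s := det₂ (η - A) v / det₂ u v) (t := det₂ u (η - A) / det₂ u v)
    (by linarith) (by linarith) (by linarith) ?_
  rw [← cramer₂ u v (η - A) hD]
  abel

/-- **Edge points.** If `ξ = A + s(B − A)` with `0 < s < 1` and `P`, `Q` lie on opposite sides of
the line `AB` (`det(B − A, P − A) > 0 > det(B − A, Q − A)`), a ball around `ξ` lies in
`conv{A, B, P} ∪ conv{A, B, Q}`. [folklore] -/
private theorem exists_ball_subset_of_edge {A B P Q ξ : Plane} {s : ℝ} (hs : 0 < s) (hs1 : s < 1)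
    (hξ : ξ = A + s • (B - A)) (hP : 0 < det₂ (B - A) (P - A)) (hQ : det₂ (B - A) (Q - A) < 0) :
    ∃ ε > 0, ball ξ ε ⊆
      convexHull ℝ ({A, B, P} : Set Plane) ∪ convexHull ℝ ({A, B, Q} : Set Plane) := by
  set u := B - A with hu
  set v := P - A with hv
  set w := Q - A with hw
  set M := ‖u‖ + ‖v‖ + ‖w‖ + 1 with hMdef
  set m := min s (1 - s) with hmdef
  set Dm := min (det₂ u v) (-det₂ u w) with hDmdef
  have hm : 0 < m := lt_min hs (by linarith)
  have hms : m ≤ s := min_le_left _ _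
  have hms' : m ≤ 1 - s := min_le_right _ _
  have hM : 0 < M := by positivity
  have hDm : 0 < Dm := lt_min hP (by linarith)
  have hDm1 : Dm ≤ |det₂ u v| := (min_le_left _ _).trans (le_abs_self _)
  have hDm2 : Dm ≤ |det₂ u w| := by
    rw [abs_of_neg hQ]; exact min_le_right _ _
  refine ⟨m * Dm / (2 * M), by positivity, fun η hη => ?_⟩
  rw [mem_ball, dist_eq_norm] at hη
  have hξA : ξ - A = s • u + (0 : ℝ) • v := by rw [hξ, zero_smul, add_zero]; abel
  have hξA' : ξ - A = s • u + (0 : ℝ) • w := by rw [hξ, zero_smul, add_zero]; abel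
  have hsmall : ∀ {D : ℝ}, Dm ≤ |D| → ‖η - ξ‖ * M / |D| < m / 2 := fun {D} hD => by
    have hDpos : 0 < |D| := lt_of_lt_of_le hDm hD
    rw [div_lt_iff₀ hDpos]
    calc ‖η - ξ‖ * M < m * Dm / (2 * M) * M := by gcongr
      _ = m / 2 * Dm := by field_simp
      _ ≤ m / 2 * |D| := by gcongr
  by_cases hside : 0 ≤ det₂ u (η - A)
  · -- the `P` side
    left
    have hD : det₂ u v ≠ 0 := hP.ne'
    have ha0 : det₂ (ξ - A) v / det₂ u v = s := by
      rw [hξA, det₂_smul_add_smul_left, mul_div_assoc, div_self hD, mul_one]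
    have hb0 : det₂ u (ξ - A) / det₂ u v = 0 := by
      rw [hξA, det₂_smul_add_smul_right, zero_mul, zero_div]
    obtain ⟨hpa, hpb⟩ := coeff_perturb u v (η - A) (ξ - A) hD
    rw [sub_sub_sub_cancel_right, ha0] at hpa
    rw [sub_sub_sub_cancel_right, hb0, sub_zero] at hpb
    have h1 : ‖η - ξ‖ * ‖v‖ / |det₂ u v| < m / 2 :=
      lt_of_le_of_lt (by gcongr; linarith [norm_nonneg u, norm_nonneg v, norm_nonneg w])
        (hsmall hDm1)
    have h2 : ‖η - ξ‖ * ‖u‖ / |det₂ u v| < m / 2 :=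
      lt_of_le_of_lt (by gcongr; linarith [norm_nonneg u, norm_nonneg v, norm_nonneg w])
        (hsmall hDm1)
    have ha := abs_le.1 (hpa.trans h1.le)
    have hb := abs_le.1 (hpb.trans h2.le)
    have hb' : 0 ≤ det₂ u (η - A) / det₂ u v := div_nonneg hside hP.le
    refine mem_convexHull_triple (s := det₂ (η - A) v / det₂ u v)
      (t := det₂ u (η - A) / det₂ u v) (by linarith) hb' (by linarith) ?_
    rw [← cramer₂ u v (η - A) hD]
    abel
  · -- the `Q` side
    right
    rw [not_le] at hside
    have hD : det₂ u w ≠ 0 := hQ.ne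
    have ha0 : det₂ (ξ - A) w / det₂ u w = s := by
      rw [hξA', det₂_smul_add_smul_left, mul_div_assoc, div_self hD, mul_one]
    have hb0 : det₂ u (ξ - A) / det₂ u w = 0 := by
      rw [hξA', det₂_smul_add_smul_right, zero_mul, zero_div]
    obtain ⟨hpa, hpb⟩ := coeff_perturb u w (η - A) (ξ - A) hD
    rw [sub_sub_sub_cancel_right, ha0] at hpa
    rw [sub_sub_sub_cancel_right, hb0, sub_zero] at hpb
    have h1 : ‖η - ξ‖ * ‖w‖ / |det₂ u w| < m / 2 :=
      lt_of_le_of_lt (by gcongr; linarith [norm_nonneg u, norm_nonneg v, norm_nonneg w])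
        (hsmall hDm2)
    have h2 : ‖η - ξ‖ * ‖u‖ / |det₂ u w| < m / 2 :=
      lt_of_le_of_lt (by gcongr; linarith [norm_nonneg u, norm_nonneg v, norm_nonneg w])
        (hsmall hDm2)
    have ha := abs_le.1 (hpa.trans h1.le)
    have hb := abs_le.1 (hpb.trans h2.le)
    have hb' : 0 ≤ det₂ u (η - A) / det₂ u w := (div_pos_of_neg_of_neg hside hQ).le
    refine mem_convexHull_triple (s := det₂ (η - A) w / det₂ u w)
      (t := det₂ u (η - A) / det₂ u w) (by linarith) hb' (by linarith) ?_
    rw [← cramer₂ u w (η - A) hD]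
    abel

/-- **Vertices.** If `P₀, …, P₅` (indices mod 6) surround `A` with positively oriented, uniformly
non-degenerate triangles `A, P_i, P_{i+1}` (`det ≥ δ > 0`) whose outer sides have length `≤ L`,
then the ball `B(A, δ/L)` lies in the fan `⋃_i conv{A, P_i, P_{i+1}}`. [folklore] -/
private theorem ball_subset_fan {A : Plane} {P : Fin 6 → Plane} {δ L : ℝ} (hδ : 0 < δ)
    (hL : 0 < L) (hdet : ∀ i, δ ≤ det₂ (P i - A) (P (i + 1) - A))
    (hlen : ∀ i, ‖P (i + 1) - P i‖ ≤ L) :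
    ball A (δ / L) ⊆ ⋃ i, convexHull ℝ ({A, P i, P (i + 1)} : Set Plane) := by
  intro η hη
  rw [mem_ball, dist_eq_norm] at hη
  obtain ⟨i, h1, h2⟩ :=
    exists_sector (fun i => P i - A) (fun i => lt_of_lt_of_le hδ (hdet i)) (η - A)
  refine mem_iUnion.2 ⟨i, ?_⟩
  set u := P i - A with hu
  set v := P (i + 1) - A with hv
  have hD : 0 < det₂ u v := lt_of_lt_of_le hδ (hdet i)
  have hvu : v - u = P (i + 1) - P i := by rw [hu, hv]; abel
  -- `s + t = det(η − A, v − u)/D < 1`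
  have hsum : det₂ (η - A) v / det₂ u v + det₂ u (η - A) / det₂ u v < 1 := by
    rw [← add_div, div_lt_one hD, det₂_swap' (η - A) u, ← sub_eq_add_neg, ← det₂_sub_right, hvu]
    calc det₂ (η - A) (P (i + 1) - P i) ≤ |det₂ (η - A) (P (i + 1) - P i)| := le_abs_self _
      _ ≤ ‖η - A‖ * ‖P (i + 1) - P i‖ := abs_det₂_le _ _
      _ ≤ ‖η - A‖ * L := by gcongr; exact hlen i
      _ < δ / L * L := by gcongr
      _ = δ := by field_simp
      _ ≤ det₂ u v := hdet i
  refine mem_convexHull_triple (s := det₂ (η - A) v / det₂ u v) (t := det₂ u (η - A) / det₂ u v)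
    (div_nonneg h2 hD.le) (div_nonneg h1 hD.le) hsum.le ?_
  rw [← cramer₂ u v (η - A) hD.ne']
  abel

end LocalCover

/-! ### Triangles of a configuration -/

section Configuration

variable {X : Type*} {α : ℝ} {y : X → Plane}

/-- Squares of lengths in `[1−α, 1+α]`, `α ≤ 1/200`. [folklore] -/
private theorem sq_bounds {t : ℝ} (hα : 0 < α) (hα' : α ≤ 1 / 200) (ht : 1 - α ≤ t)
    (ht' : t ≤ 1 + α) : 39601 / 40000 ≤ t ^ 2 ∧ t ^ 2 ≤ 40401 / 40000 := by
  have h1 : (199 / 200 : ℝ) ≤ t := by linarith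
  have h2 : t ≤ 201 / 200 := by linarith
  have h0 : 0 ≤ t := by linarith
  constructor <;> nlinarith

/-- A triangle with all three sides in `[1−α, 1+α]` (`0 < α ≤ 1/200`) is uniformly
non-degenerate: `det(u, v)² ≥ (21/25)²` for two of its edge vectors `u, v` at a common vertex.
[folklore] -/
private theorem sq_le_det₂_sq (hα : 0 < α) (hα' : α ≤ 1 / 200) {u v : Plane}
    (hu : 1 - α ≤ ‖u‖) (hu' : ‖u‖ ≤ 1 + α) (hv : 1 - α ≤ ‖v‖) (hv' : ‖v‖ ≤ 1 + α)
    (huv : 1 - α ≤ ‖u - v‖) (huv' : ‖u - v‖ ≤ 1 + α) :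
    (21 / 25 : ℝ) ^ 2 ≤ det₂ u v ^ 2 := by
  obtain ⟨a1, a2⟩ := sq_bounds hα hα' hu hu'
  obtain ⟨b1, b2⟩ := sq_bounds hα hα' hv hv'
  obtain ⟨c1, c2⟩ := sq_bounds hα hα' huv huv'
  have hL := dotc_sq_add_det₂_sq u v
  have hN := norm_sub_sq_dotc u v
  have hP0 : 0 ≤ dotc u v := by linarith
  have hP1 : dotc u v ≤ 41201 / 80000 := by linarith
  have hP2 : dotc u v ^ 2 ≤ (41201 / 80000) ^ 2 := pow_le_pow_left₀ hP0 hP1 2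
  have hprod : (39601 / 40000 : ℝ) * (39601 / 40000) ≤ ‖u‖ ^ 2 * ‖v‖ ^ 2 :=
    mul_le_mul a1 b1 (by norm_num) (by positivity)
  nlinarith

/-- An `𝒮`-triangle is uniformly non-degenerate: `det(y(b) − y(a), y(c) − y(a))² ≥ (21/25)²`
(`0 < α ≤ 1/200`). [cite: Theil2006, §2.3 before Definition 2.4 «(13) implies … cannot be
deformed continuously» (preprint p. 7); our constant] -/
theorem sq_le_det₂_sq_of_isShortRange (hα : 0 < α) (hα' : α ≤ 1 / 200) {a b c : X}
    (hab : IsShortRange α y a b) (hac : IsShortRange α y a c) (hbc : IsShortRange α y b c) :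
    (21 / 25 : ℝ) ^ 2 ≤ det₂ (y b - y a) (y c - y a) ^ 2 := by
  apply sq_le_det₂_sq hα hα'
  · rw [← dist_eq_norm, dist_comm]; exact hab.le_dist
  · rw [← dist_eq_norm, dist_comm]; exact hab.dist_le
  · rw [← dist_eq_norm, dist_comm]; exact hac.le_dist
  · rw [← dist_eq_norm, dist_comm]; exact hac.dist_le
  · rw [sub_sub_sub_cancel_right, ← dist_eq_norm]; exact hbc.le_dist
  · rw [sub_sub_sub_cancel_right, ← dist_eq_norm]; exact hbc.dist_le

/-- The triangles of a hexagonal wheel have `det ≥ 21/25`. [cite: Theil2006, §4.2 Lemma 4.7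
(preprint p. 20); our constant] -/
theorem IsHexagonalNbhd.le_det₂ {x : X} {p : Fin 6 → X} (H : IsHexagonalNbhd α y x p)
    (hα : 0 < α) (hα' : α ≤ 1 / 200) (i : Fin 6) :
    21 / 25 ≤ det₂ (y (p i) - y x) (y (p (i + 1)) - y x) := by
  have hsq := sq_le_det₂_sq_of_isShortRange hα hα' (H.isShortRange_centre i)
    (H.isShortRange_centre (i + 1)) (H.isShortRange_succ i)
  exact (pow_le_pow_iff_left₀ (by norm_num) (H.det_pos i).le two_ne_zero).1 hsq

/-- Three mutually short-range particles form a simplex of `𝒯₁(y)` (a private copy of the tree's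
`isEquilateralSimplex_one_triple` of `Theil2006DefectiveBondCount.lean`, not imported here).
[cite: Theil2006, §2.3 Definition 2.6, case λ = 1 (preprint p. 8)] -/
private theorem isEquilateralSimplex_one_triple' [DecidableEq X] (hα1 : α < 1) {a b c : X}
    (hab : IsShortRange α y a b) (hac : IsShortRange α y a c) (hbc : IsShortRange α y b c) :
    IsEquilateralSimplex α y 1 ({a, b, c} : Finset X) := by
  rw [isEquilateralSimplex_one_iff]
  refine ⟨Finset.card_eq_three.2 ⟨a, b, c, hab.ne hα1, hac.ne hα1, hbc.ne hα1, rfl⟩, ?_⟩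
  intro z hz z' hz' hne
  simp only [Finset.mem_insert, Finset.mem_singleton] at hz hz'
  rcases hz with rfl | rfl | rfl <;> rcases hz' with rfl | rfl | rfl <;>
    first
    | exact absurd rfl hne
    | exact hab
    | exact hab.symm
    | exact hac
    | exact hac.symm
    | exact hbc
    | exact hbc.symm

/-- The image of a listed triangle. [folklore] -/
private theorem image_coe_triple [DecidableEq X] (a b c : X) :
    y '' (↑({a, b, c} : Finset X)) = ({y a, y b, y c} : Set Plane) := by
  rw [Finset.coe_insert, Finset.coe_insert, Finset.coe_singleton, image_insert_eq,
    image_insert_eq, image_singleton]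

/-- A point of a segment is no farther from `z` than the farther endpoint. [folklore] -/
private theorem dist_le_of_on_segment {A B ξ z : Plane} {m s : ℝ} (hA : dist A z ≤ m)
    (hB : dist B z ≤ m) (hs0 : 0 ≤ s) (hs1 : s ≤ 1) (hξ : ξ = A + s • (B - A)) :
    dist ξ z ≤ m := by
  have hseg : ξ ∈ segment ℝ A B := ⟨1 - s, s, by linarith, hs0, by ring, by rw [hξ]; module⟩
  exact mem_closedBall.1 ((convex_closedBall z m).segment_subset (mem_closedBall.2 hA)
    (mem_closedBall.2 hB) hseg)

/-- A point of a triangle is no farther from `z` than the farthest vertex. [folklore] -/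
private theorem dist_le_of_mem_convexHull_triple {A B C ξ z : Plane} {m : ℝ} (hA : dist A z ≤ m)
    (hB : dist B z ≤ m) (hC : dist C z ≤ m) (hξ : ξ ∈ convexHull ℝ ({A, B, C} : Set Plane)) :
    dist ξ z ≤ m := by
  have h : convexHull ℝ ({A, B, C} : Set Plane) ⊆ closedBall z m := by
    refine convexHull_min ?_ (convex_closedBall z m)
    intro w hw
    simp only [mem_insert_iff, mem_singleton_iff] at hw
    rcases hw with rfl | rfl | rfl <;> exact mem_closedBall.2 ‹_›
  exact mem_closedBall.1 (h hξ)

/-- Barycentric coordinates of a point of `conv{A, B, C}`. [folklore] -/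
private theorem exists_barycentric {A B C ξ : Plane}
    (hξ : ξ ∈ convexHull ℝ ({A, B, C} : Set Plane)) :
    ∃ a b c : ℝ, 0 ≤ a ∧ 0 ≤ b ∧ 0 ≤ c ∧ a + b + c = 1 ∧ ξ = a • A + b • B + c • C := by
  rw [convexHull_insert (insert_nonempty _ _), convexHull_pair, mem_convexJoin] at hξ
  obtain ⟨a', ha', M, hM, hξ⟩ := hξ
  rw [mem_singleton_iff] at ha'
  subst ha'
  obtain ⟨p, q, hp, hq, hpq, rfl⟩ := hM
  obtain ⟨l, m, hl, hm, hlm, rfl⟩ := hξ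
  refine ⟨l, m * p, m * q, hl, mul_nonneg hm hp, mul_nonneg hm hq,
    by linear_combination hlm + m * hpq, ?_⟩
  rw [smul_add, smul_smul, smul_smul, add_assoc]

/-! ### Local covers (the openness half of the continuity argument for (63)) -/

/-- **At a vertex.** Around a particle `x ∈ X ∖ 𝒩(∂X)` ((13), `0 < α ≤ 1/200`) the ball
`B(y(x), (21/25)/(1+α))` is covered by the six wheel triangles `{x, p_i, p_{i+1}} ∈ 𝒯₁(y)`, all
of whose vertices lie within `1 + α` of `y(x)`. [cite: Theil2006, §4.2 proof of Proposition 4.8,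
(63) via Lemma 4.7 (preprint pp. 20–21); our radius] -/
theorem exists_cover_nhds_vertex (hα : 0 < α) (hα' : α ≤ 1 / 200)
    (hsep : ∀ x x' : X, x ≠ x' → 1 - α < dist (y x) (y x')) {x : X}
    (hx : x ∉ defectSet α y) (hN : ∀ ⦃b⦄, IsShortRange α y x b → b ∉ defectSet α y) :
    ∃ ε > 0, ∀ η ∈ ball (y x) ε, ∃ T : Finset X, IsEquilateralSimplex α y 1 T ∧
      (∀ z ∈ T, dist (y z) (y x) ≤ 1 + α) ∧ η ∈ convexHull ℝ (y '' ↑T) := by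
  classical
  have hα1 : α < 1 := by linarith
  have hne : ({x' | IsShortRange α y x x'} : Set X).Nonempty :=
    Set.nonempty_of_ncard_ne_zero (by rw [ncard_neighbours_eq_six hα1 hx]; norm_num)
  obtain ⟨x', hx'⟩ := hne
  obtain ⟨p, -, H⟩ := exists_isHexagonalNbhd hα hα' hsep hx hN hx'
  have hdet : ∀ i, (21 / 25 : ℝ) ≤ det₂ (y (p i) - y x) (y (p (i + 1)) - y x) :=
    fun i => H.le_det₂ hα hα' i
  have hlen : ∀ i, ‖y (p (i + 1)) - y (p i)‖ ≤ 1 + α := fun i => by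
    rw [← dist_eq_norm, dist_comm]; exact (H.isShortRange_succ i).dist_le
  refine ⟨21 / 25 / (1 + α), by positivity, fun η hη => ?_⟩
  obtain ⟨i, hi⟩ := mem_iUnion.1 (ball_subset_fan (by norm_num) (by linarith) hdet hlen hη)
  refine ⟨{x, p i, p (i + 1)}, isEquilateralSimplex_one_triple' hα1 (H.isShortRange_centre i)
    (H.isShortRange_centre (i + 1)) (H.isShortRange_succ i), ?_, ?_⟩
  · intro z hz
    simp only [Finset.mem_insert, Finset.mem_singleton] at hz
    rcases hz with rfl | rfl | rfl
    · rw [dist_self]; linarith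
    · rw [dist_comm]; exact (H.isShortRange_centre i).dist_le
    · rw [dist_comm]; exact (H.isShortRange_centre (i + 1)).dist_le
  · rwa [image_coe_triple]

/-- **On an edge.** If `{x₁, x₂} ∈ 𝒮(y)` with `x₁, x₂ ∉ ∂X` ((13), `0 < α ≤ 1/200`) and `ξ` is
an inner point of the segment `[y(x₁), y(x₂)]`, a ball around `ξ` is covered by the two
triangles of `𝒯₁(y)` through `{x₁, x₂}` on either side (third vertices: the counter-clockwise
successor of `x₂` around `x₁` and of `x₁` around `x₂`), whose vertices lie within `1 + α` of `ξ`.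
[cite: Theil2006, §4.2 proof of Proposition 4.8, (63) via Lemma 4.7 (preprint pp. 20–21)] -/
theorem exists_cover_nhds_edge (hα : 0 < α) (hα' : α ≤ 1 / 200)
    (hsep : ∀ x x' : X, x ≠ x' → 1 - α < dist (y x) (y x')) {x₁ x₂ : X}
    (h12 : IsShortRange α y x₁ x₂) (hx₁ : x₁ ∉ defectSet α y) (hx₂ : x₂ ∉ defectSet α y)
    {ξ : Plane} {s : ℝ} (hs : 0 < s) (hs1 : s < 1) (hξ : ξ = y x₁ + s • (y x₂ - y x₁)) :
    ∃ ε > 0, ∀ η ∈ ball ξ ε, ∃ T : Finset X, IsEquilateralSimplex α y 1 T ∧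
      (∀ z ∈ T, dist (y z) ξ ≤ 1 + α) ∧ η ∈ convexHull ℝ (y '' ↑T) := by
  classical
  have hα1 : α < 1 := by linarith
  obtain ⟨p, θ, E₁⟩ := exists_ccwNbhd hα hα' hsep hx₁ h12
  obtain ⟨q, θ', E₂⟩ := exists_ccwNbhd hα hα' hsep hx₂ h12.symm
  have e01 : (0 : Fin 6) + 1 = 1 := by decide
  have hp0 : p 0 = x₂ := E₁.p_zero
  have hq0 : q 0 = x₁ := E₂.p_zero
  -- orientations
  have hP : 0 < det₂ (y x₂ - y x₁) (y (p 1) - y x₁) := by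
    have h := E₁.det₂_pos hα1 0
    rwa [e01, hp0] at h
  have hQ : det₂ (y x₂ - y x₁) (y (q 1) - y x₁) < 0 := by
    have h := E₂.det₂_pos hα1 0
    rw [e01, hq0] at h
    rw [det₂_flip_base]
    linarith
  -- bonds
  have h1p : IsShortRange α y x₁ (p 1) := E₁.isShortRange 1
  have h2p : IsShortRange α y x₂ (p 1) := by
    have h := E₁.isShortRange_succ hα hα' hsep 0 (by rw [hp0]; exact hx₂)
    rwa [e01, hp0] at h
  have h2q : IsShortRange α y x₂ (q 1) := E₂.isShortRange 1
  have h1q : IsShortRange α y x₁ (q 1) := by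
    have h := E₂.isShortRange_succ hα hα' hsep 0 (by rw [hq0]; exact hx₁)
    rwa [e01, hq0] at h
  -- distances to `ξ`
  have hd12 : dist (y x₁) (y x₂) ≤ 1 + α := h12.dist_le
  have hdist : ∀ z, IsShortRange α y x₁ z → IsShortRange α y x₂ z → dist (y z) ξ ≤ 1 + α :=
    fun z h1 h2 => by
      rw [dist_comm]
      exact dist_le_of_on_segment h1.dist_le h2.dist_le hs.le hs1.le hξ
  have hdx₁ : dist (y x₁) ξ ≤ 1 + α := by
    rw [dist_comm]
    exact dist_le_of_on_segment (by rw [dist_self]; linarith) (by rw [dist_comm]; exact hd12)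
      hs.le hs1.le hξ
  have hdx₂ : dist (y x₂) ξ ≤ 1 + α := by
    rw [dist_comm]
    exact dist_le_of_on_segment hd12 (by rw [dist_self]; linarith) hs.le hs1.le hξ
  obtain ⟨ε, hε, hball⟩ := exists_ball_subset_of_edge hs hs1 hξ hP hQ
  refine ⟨ε, hε, fun η hη => ?_⟩
  rcases hball hη with h | h
  · refine ⟨{x₁, x₂, p 1}, isEquilateralSimplex_one_triple' hα1 h12 h1p h2p, ?_, ?_⟩
    · intro z hz
      simp only [Finset.mem_insert, Finset.mem_singleton] at hz
      rcases hz with rfl | rfl | rfl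
      · exact hdx₁
      · exact hdx₂
      · exact hdist _ h1p h2p
    · rwa [image_coe_triple]
  · refine ⟨{x₁, x₂, q 1}, isEquilateralSimplex_one_triple' hα1 h12 h1q h2q, ?_, ?_⟩
    · intro z hz
      simp only [Finset.mem_insert, Finset.mem_singleton] at hz
      rcases hz with rfl | rfl | rfl
      · exact hdx₁
      · exact hdx₂
      · exact hdist _ h1q h2q
    · rwa [image_coe_triple]

/-- **Local cover.** Let `ξ ∈ conv(y(T₀))` for some `T₀ ∈ 𝒯₁(y)` ((13), `0 < α ≤ 1/200`), and
suppose no particle within `1 + α` of `ξ` is a defect.  Then a whole ball around `ξ` is covered by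
triangles `conv(y(T))`, `T ∈ 𝒯₁(y)`, with all vertices within `1 + α` of `ξ` — the openness step
of the continuity argument proving (63). [cite: Theil2006, §4.2 proof of Proposition 4.8, (63)
(preprint p. 21)] -/
theorem exists_cover_nhds (hα : 0 < α) (hα' : α ≤ 1 / 200)
    (hsep : ∀ x x' : X, x ≠ x' → 1 - α < dist (y x) (y x')) {T₀ : Finset X}
    (hT₀ : IsEquilateralSimplex α y 1 T₀) {ξ : Plane} (hξ : ξ ∈ convexHull ℝ (y '' ↑T₀))
    (hgood : ∀ b : X, dist (y b) ξ ≤ 1 + α → b ∉ defectSet α y) :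
    ∃ ε > 0, ∀ η ∈ ball ξ ε, ∃ T : Finset X, IsEquilateralSimplex α y 1 T ∧
      (∀ z ∈ T, dist (y z) ξ ≤ 1 + α) ∧ η ∈ convexHull ℝ (y '' ↑T) := by
  classical
  have hα1 : α < 1 := by linarith
  obtain ⟨h3, hS⟩ := isEquilateralSimplex_one_iff.1 hT₀
  obtain ⟨x₁, x₂, x₃, h12ne, h13ne, h23ne, rfl⟩ := Finset.card_eq_three.1 h3
  have h12 : IsShortRange α y x₁ x₂ := hS x₁ (by simp) x₂ (by simp) h12ne
  have h13 : IsShortRange α y x₁ x₃ := hS x₁ (by simp) x₃ (by simp) h13ne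
  have h23 : IsShortRange α y x₂ x₃ := hS x₂ (by simp) x₃ (by simp) h23ne
  rw [image_coe_triple] at hξ
  -- all three vertices are within `1 + α` of `ξ`, hence not defects
  have hd : ∀ z ∈ ({x₁, x₂, x₃} : Finset X), dist (y z) ξ ≤ 1 + α := by
    intro z hz
    rw [dist_comm]
    simp only [Finset.mem_insert, Finset.mem_singleton] at hz
    rcases hz with rfl | rfl | rfl
    · exact dist_le_of_mem_convexHull_triple (by rw [dist_self]; linarith)
        (by rw [dist_comm]; exact h12.dist_le) (by rw [dist_comm]; exact h13.dist_le) hξ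
    · exact dist_le_of_mem_convexHull_triple h12.dist_le (by rw [dist_self]; linarith)
        (by rw [dist_comm]; exact h23.dist_le) hξ
    · exact dist_le_of_mem_convexHull_triple h13.dist_le h23.dist_le
        (by rw [dist_self]; linarith) hξ
  have hx₁ : x₁ ∉ defectSet α y := hgood x₁ (hd x₁ (by simp))
  have hx₂ : x₂ ∉ defectSet α y := hgood x₂ (hd x₂ (by simp))
  have hx₃ : x₃ ∉ defectSet α y := hgood x₃ (hd x₃ (by simp))
  -- the vertex case, at any particle `x` with `ξ = y x`
  have vertex : ∀ x : X, ξ = y x →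
      ∃ ε > 0, ∀ η ∈ ball ξ ε, ∃ T : Finset X, IsEquilateralSimplex α y 1 T ∧
        (∀ z ∈ T, dist (y z) ξ ≤ 1 + α) ∧ η ∈ convexHull ℝ (y '' ↑T) := by
    rintro x rfl
    have hx : x ∉ defectSet α y := hgood x (by rw [dist_self]; linarith)
    exact exists_cover_nhds_vertex hα hα' hsep hx
      (fun b hb => hgood b (by rw [dist_comm]; exact hb.dist_le))
  -- the edge case, for any short-range pair of non-defects
  have edge : ∀ a b : X, IsShortRange α y a b → a ∉ defectSet α y → b ∉ defectSet α y →
      ∀ s : ℝ, 0 < s → s < 1 → ξ = y a + s • (y b - y a) →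
      ∃ ε > 0, ∀ η ∈ ball ξ ε, ∃ T : Finset X, IsEquilateralSimplex α y 1 T ∧
        (∀ z ∈ T, dist (y z) ξ ≤ 1 + α) ∧ η ∈ convexHull ℝ (y '' ↑T) :=
    fun a b hab ha hb s hs hs1 hξ' => exists_cover_nhds_edge hα hα' hsep hab ha hb hs hs1 hξ'
  obtain ⟨a, b, c, ha, hb, hc, habc, hξabc⟩ := exists_barycentric hξ
  rcases ha.eq_or_lt with rfl | ha'
  · -- `a = 0`: `ξ` on the edge `[y x₂, y x₃]` or at one of its ends
    rcases hb.eq_or_lt with rfl | hb'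
    · have hc1 : c = 1 := by linarith
      exact vertex x₃ (by rw [hξabc, hc1]; simp)
    rcases hc.eq_or_lt with rfl | hc'
    · have hb1 : b = 1 := by linarith
      exact vertex x₂ (by rw [hξabc, hb1]; simp)
    · refine edge x₂ x₃ h23 hx₂ hx₃ c hc' (by linarith) ?_
      rw [hξabc, show b = 1 - c by linarith]
      module
  rcases hb.eq_or_lt with rfl | hb'
  · rcases hc.eq_or_lt with rfl | hc'
    · have ha1 : a = 1 := by linarith
      exact vertex x₁ (by rw [hξabc, ha1]; simp)
    · refine edge x₁ x₃ h13 hx₁ hx₃ c hc' (by linarith) ?_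
      rw [hξabc, show a = 1 - c by linarith]
      module
  rcases hc.eq_or_lt with rfl | hc'
  · refine edge x₁ x₂ h12 hx₁ hx₂ b hb' (by linarith) ?_
    rw [hξabc, show a = 1 - b by linarith]
    module
  -- the interior case
  have hD : det₂ (y x₂ - y x₁) (y x₃ - y x₁) ≠ 0 := fun h0 => by
    have := sq_le_det₂_sq_of_isShortRange hα hα' h12 h13 h23
    rw [h0] at this
    norm_num at this
  obtain ⟨ε, hε, hball⟩ := exists_ball_subset_of_interior (A := y x₁) (B := y x₂) (C := y x₃)
    (ξ := ξ) hb' hc' (by linarith) (by rw [hξabc, show a = 1 - b - c by linarith]; module) hD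
  refine ⟨ε, hε, fun η hη => ⟨{x₁, x₂, x₃}, hT₀, hd, ?_⟩⟩
  rw [image_coe_triple]
  exact hball hη

/-! ### (63): defect-free balls are covered by the short-range triangles -/

/-- **Theil 2006, Appendix, proof of Proposition 4.8, display (63)** —
"`Ω₂ ⊂ ∪_{T ∈ 𝒯₁} conv(y(T))`", `Ω₂ = {η ∈ Ω | dist(η, ∂Ω) ≥ 2}` — for balls.  Let `y` satisfy
(13) (`|y(x) − y(x′)| > 1 − α` for `x ≠ x′`) with `0 < α ≤ 1/200` and finitely many particles, let
`Ω = B(c, R)` contain no defect, `Ω ∩ y(∂X) = ∅`, and let `r + 2 ≤ R`.  If some particle lies in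
`B(c, r)` (the print: "It can be assumed wlog that there exists `x₀ ∈ y⁻¹(Ω₂)`"), then every point
of `B(c, r)` lies in `conv(y(T))` for a simplex `T ∈ 𝒯₁(y)` with all vertices in `Ω`.  Proof as
printed (p. 21), by continuity: the covered part of the ball is relatively closed (finitely many
closed triangles) and relatively open (Lemma 4.7: around a vertex the six wheel triangles, across
an edge the two adjacent triangles — `exists_cover_nhds`), and the ball is connected.
[cite: Theil2006, §4.2 proof of Proposition 4.8, (63) (preprint p. 21)] -/
theorem exists_simplex_mem_convexHull_of_mem_ball [Finite X] (hα : 0 < α) (hα' : α ≤ 1 / 200)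
    (hsep : ∀ x x' : X, x ≠ x' → 1 - α < dist (y x) (y x')) {c : Plane} {r R : ℝ}
    (hrR : r + 2 ≤ R) (hdef : ∀ b ∈ defectSet α y, R ≤ dist (y b) c) {x₀ : X}
    (hx₀ : y x₀ ∈ ball c r) {ξ : Plane} (hξ : ξ ∈ ball c r) :
    ∃ T : Finset X, IsEquilateralSimplex α y 1 T ∧ (∀ z ∈ T, y z ∈ ball c R) ∧
      ξ ∈ convexHull ℝ (y '' ↑T) := by
  classical
  have hα1 : α < 1 := by linarith
  -- the cover `U` and its index set
  set 𝒯 : Set (Finset X) := {T | IsEquilateralSimplex α y 1 T ∧ ∀ z ∈ T, y z ∈ ball c R} with h𝒯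
  set U : Set Plane := ⋃ T ∈ 𝒯, convexHull ℝ (y '' ↑T) with hU
  suffices hsub : ball c r ⊆ U by
    obtain ⟨T, hT, hξT⟩ := mem_iUnion₂.1 (hsub hξ)
    exact ⟨T, hT.1, hT.2, hξT⟩
  -- no defect near a point of `B(c, r)`
  have hgood : ∀ ξ ∈ ball c r, ∀ b : X, dist (y b) ξ ≤ 1 + α → b ∉ defectSet α y := by
    intro ξ hξ b hb hbdef
    have h1 := hdef b hbdef
    have h2 : dist (y b) c ≤ dist (y b) ξ + dist ξ c := dist_triangle _ _ _
    rw [mem_ball] at hξ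
    linarith
  -- near triangles are triangles of the cover
  have hnear : ∀ ξ ∈ ball c r, ∀ T : Finset X, IsEquilateralSimplex α y 1 T →
      (∀ z ∈ T, dist (y z) ξ ≤ 1 + α) → T ∈ 𝒯 := by
    intro ξ hξ T hT hd
    refine ⟨hT, fun z hz => ?_⟩
    rw [mem_ball] at hξ ⊢
    have h2 : dist (y z) c ≤ dist (y z) ξ + dist ξ c := dist_triangle _ _ _
    linarith [hd z hz]
  -- `U` is closed
  have hUclosed : IsClosed U := by
    haveI := Fintype.ofFinite X
    refine (Set.toFinite 𝒯).isClosed_biUnion fun T _ => ?_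
    exact ((T.finite_toSet.image y).isCompact_convexHull ℝ).isClosed
  -- `U` is relatively open in the ball
  have hloc : ∀ ξ ∈ ball c r, ξ ∈ U → ξ ∈ interior U := by
    intro ξ hξ hξU
    obtain ⟨T₀, hT₀, hξT₀⟩ := mem_iUnion₂.1 hξU
    obtain ⟨ε, hε, hcov⟩ := exists_cover_nhds hα hα' hsep hT₀.1 hξT₀ (hgood ξ hξ)
    refine mem_interior.2 ⟨ball ξ ε, fun η hη => ?_, isOpen_ball, mem_ball_self hε⟩
    obtain ⟨T, hT, hd, hηT⟩ := hcov η hη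
    exact mem_iUnion₂.2 ⟨T, hnear ξ hξ T hT hd, hηT⟩
  -- the particle `x₀` gives a point of the ball inside `U`
  have hx₀U : y x₀ ∈ U := by
    have hx₀d : x₀ ∉ defectSet α y := hgood (y x₀) hx₀ x₀ (by rw [dist_self]; linarith)
    obtain ⟨ε, hε, hcov⟩ := exists_cover_nhds_vertex hα hα' hsep hx₀d
      (fun b hb => hgood (y x₀) hx₀ b (by rw [dist_comm]; exact hb.dist_le))
    obtain ⟨T, hT, hd, hT'⟩ := hcov (y x₀) (mem_ball_self hε)
    exact mem_iUnion₂.2 ⟨T, hnear (y x₀) hx₀ T hT hd, hT'⟩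
  -- continuity argument
  have hpre : IsPreconnected (ball c r) := (convex_ball c r).isPreconnected
  have key : ball c r ⊆ interior U :=
    hpre.subset_left_of_subset_union isOpen_interior hUclosed.isOpen_compl
      (disjoint_compl_right.mono_left interior_subset)
      (fun ξ hξ => by
        by_cases h : ξ ∈ U
        · exact Or.inl (hloc ξ hξ h)
        · exact Or.inr h)
      ⟨y x₀, hx₀, hloc (y x₀) hx₀ hx₀U⟩
  exact key.trans interior_subset

/-- **(63), set form**: `B(c, r) ⊆ ⋃_{T ∈ 𝒯₁(y), y(T) ⊂ B(c, R)} conv(y(T))` under the hypotheses of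
`exists_simplex_mem_convexHull_of_mem_ball`. [cite: Theil2006, §4.2 proof of Proposition 4.8, (63)
(preprint p. 21)] -/
theorem ball_subset_biUnion_convexHull [Finite X] (hα : 0 < α) (hα' : α ≤ 1 / 200)
    (hsep : ∀ x x' : X, x ≠ x' → 1 - α < dist (y x) (y x')) {c : Plane} {r R : ℝ}
    (hrR : r + 2 ≤ R) (hdef : ∀ b ∈ defectSet α y, R ≤ dist (y b) c) {x₀ : X}
    (hx₀ : y x₀ ∈ ball c r) :
    ball c r ⊆ ⋃ T ∈ {T : Finset X | IsEquilateralSimplex α y 1 T ∧ ∀ z ∈ T, y z ∈ ball c R},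
      convexHull ℝ (y '' ↑T) := fun ξ hξ => by
  obtain ⟨T, hT, hTR, hξT⟩ := exists_simplex_mem_convexHull_of_mem_ball hα hα' hsep hrR hdef hx₀ hξ
  exact mem_iUnion₂.2 ⟨T, ⟨hT, hTR⟩, hξT⟩

/-- **(63) for a long simplex.** For `T ∈ 𝒯_λ(y)` with `λ > 1` — Definition 2.6: no defect
within `20λ` of the barycentre `z`, and `y(T) ⊂ y(ω_T) ⊂ B̄(z, 5λ)` by (24) — the triangle
`conv(y(T))` is covered by the unit simplices `conv(y(S))`, `S ∈ 𝒯₁(y)`, with vertices in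
`B(z, 6λ + 2)` ((63) with `Ω′ = B(z, 6λ)`, `Ω = B(z, 6λ + 2) ⊂ B(z, 20λ)`): the covering half of
the partition identity "`meas(conv y(T)) = Σ_{S∈𝒯₁} meas(conv y(S) ∩ conv y(T))`" of the proof of
Proposition 2.9 (27) (Appendix p. 25, "Lemma 2.7 ="). Hypotheses: (13), `0 < α ≤ 1/200`,
finitely many particles. [cite: Theil2006, §4.2 proof of Proposition 4.8, (63) (preprint p. 21);
§2.3 Definition 2.6 (24) (p. 8); Appendix proof of Proposition 2.9 (27) (p. 25)] -/
theorem IsEquilateralSimplex.convexHull_subset_biUnion [Finite X] (hα : 0 < α) (hα' : α ≤ 1 / 200)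
    (hsep : ∀ x x' : X, x ≠ x' → 1 - α < dist (y x) (y x')) {lam : ℝ} {T : Finset X}
    (hT : IsEquilateralSimplex α y lam T) (hlam : 1 < lam) :
    convexHull ℝ (y '' ↑T) ⊆
      ⋃ S ∈ {S : Finset X | IsEquilateralSimplex α y 1 S ∧
          ∀ z ∈ S, y z ∈ ball (simplexCentre y T) (6 * lam + 2)},
        convexHull ℝ (y '' ↑S) := by
  rcases hT.2 with ⟨h1, -⟩ | ⟨-, hfar, ω, Φ, -, hTω, -, -, hω5, -⟩
  · exact absurd h1 (ne_of_gt hlam)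
  set z := simplexCentre y T
  -- the vertices lie within `5λ` of the barycentre, so the triangle lies in `B(z, 6λ)`
  have hvert : ∀ x ∈ T, y x ∈ ball z (6 * lam) := fun x hx => by
    have h5 : y x ∈ closedBall z (5 * lam) := hω5 ⟨x, hTω (Finset.mem_coe.2 hx), rfl⟩
    rw [mem_closedBall] at h5
    rw [mem_ball]
    linarith
  have hsub : convexHull ℝ (y '' ↑T) ⊆ ball z (6 * lam) := by
    refine convexHull_min ?_ (convex_ball z (6 * lam))
    rintro _ ⟨x, hx, rfl⟩
    exact hvert x (Finset.mem_coe.1 hx)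
  -- a vertex to start from
  obtain ⟨x₀, hx₀⟩ : T.Nonempty := by
    rw [← Finset.card_pos, hT.card_eq_three]; norm_num
  have hdef : ∀ b ∈ defectSet α y, 6 * lam + 2 ≤ dist (y b) z := fun b hb => by
    have := hfar b hb; linarith
  exact hsub.trans (ball_subset_biUnion_convexHull hα hα' hsep (by linarith) hdef (hvert x₀ hx₀))

end Configuration

/-! ### Local planarity under (13): short bonds do not cross, unit simplices do not overlap

The facts behind "`∂Ω(γ) = ∪_k [y(γ(k)), y(γ(k+1))]` … Jordan's curve theorem" (Definition 4.4)
and behind the partition identity "`meas(conv y(T)) = Σ_{S∈𝒯₁} meas(conv y(S) ∩ conv y(T))`"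
(Appendix p. 25): under (13) with `0 < α ≤ 1/200`, two short bonds with four distinct endpoints
are disjoint segments, a particle inside a closed unit triangle is one of its vertices (Lemma 4.7's
rider), and two distinct unit simplices have disjoint open triangles. -/

section Planarity

variable {X : Type*} {α : ℝ} {y : X → Plane}

/-- Two segments of length `≤ 1 + α` through a common point have an endpoint of the one within
`1 − α` of an endpoint of the other (`α ≤ 1/200`; in fact `α < 1/11` suffices). [folklore] -/
private theorem exists_dist_lt_of_mem_segments (hα : 0 < α) (hα' : α ≤ 1 / 200)
    {B C B' C' O : Plane} (hBC : dist B C ≤ 1 + α) (hB'C' : dist B' C' ≤ 1 + α)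
    (hO : O ∈ segment ℝ B C) (hO' : O ∈ segment ℝ B' C') :
    ∃ P, (P = B ∨ P = C) ∧ ∃ Q, (Q = B' ∨ Q = C') ∧ dist P Q < 1 - α := by
  -- an endpoint `P` of `[B, C]` within `(1 + α)/2` of `O`
  have hsum := dist_add_dist_of_mem_segment hO
  obtain ⟨P, hP, hPO⟩ : ∃ P, (P = B ∨ P = C) ∧ dist P O ≤ (1 + α) / 2 := by
    rcases le_total (dist B O) (dist O C) with h | h
    · exact ⟨B, Or.inl rfl, by linarith⟩
    · exact ⟨C, Or.inr rfl, by rw [dist_comm]; linarith⟩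
  refine ⟨P, hP, ?_⟩
  have hsum' := dist_add_dist_of_mem_segment hO'
  -- if an endpoint of `[B', C']` is very close to `O`, it is close to `P`
  by_cases hB' : dist B' O < (1 - 3 * α) / 2
  · refine ⟨B', Or.inl rfl, ?_⟩
    calc dist P B' ≤ dist P O + dist O B' := dist_triangle _ _ _
      _ < (1 + α) / 2 + (1 - 3 * α) / 2 := by rw [dist_comm O B']; linarith
      _ = 1 - α := by ring
  by_cases hC' : dist O C' < (1 - 3 * α) / 2
  · refine ⟨C', Or.inr rfl, ?_⟩
    calc dist P C' ≤ dist P O + dist O C' := dist_triangle _ _ _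
      _ < (1 + α) / 2 + (1 - 3 * α) / 2 := by linarith
      _ = 1 - α := by ring
  rw [not_lt] at hB' hC'
  have hB'le : dist B' O ≤ (1 + 5 * α) / 2 := by linarith
  have hC'le : dist O C' ≤ (1 + 5 * α) / 2 := by linarith
  -- the endpoint of `[B', C']` on the side of `P` (non-negative inner product with `P − O`)
  obtain ⟨a, b, ha, hb, hab, hO'eq⟩ := hO'
  obtain rfl : a = 1 - b := by linarith
  have hBO : B' - O = b • (B' - C') := by rw [← hO'eq]; module
  have hCO : C' - O = -((1 - b) • (B' - C')) := by rw [← hO'eq]; module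
  have key : ∀ Q : Plane, dist Q O ≤ (1 + 5 * α) / 2 → 0 ≤ inner ℝ (P - O) (Q - O) →
      dist P Q < 1 - α := by
    intro Q hQO hinner
    have h1 : ‖P - Q‖ ^ 2 = ‖P - O‖ ^ 2 - 2 * inner ℝ (P - O) (Q - O) + ‖Q - O‖ ^ 2 := by
      rw [← norm_sub_sq_real]; congr 1; abel
    rw [← dist_eq_norm, ← dist_eq_norm, ← dist_eq_norm] at h1
    have h2 : dist P Q ^ 2 < (1 - α) ^ 2 := by
      have hPO' : dist P O ^ 2 ≤ ((1 + α) / 2) ^ 2 := pow_le_pow_left₀ dist_nonneg hPO 2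
      have hQO' : dist Q O ^ 2 ≤ ((1 + 5 * α) / 2) ^ 2 := pow_le_pow_left₀ dist_nonneg hQO 2
      nlinarith
    exact lt_of_abs_lt (abs_lt_of_sq_lt_sq h2 (by linarith))
  rcases le_or_gt 0 (inner ℝ (P - O) (B' - C')) with hw | hw
  · refine ⟨B', Or.inl rfl, key B' hB'le ?_⟩
    rw [hBO, real_inner_smul_right]
    exact mul_nonneg hb hw
  · refine ⟨C', Or.inr rfl, key C' (by rwa [dist_comm]) ?_⟩
    rw [hCO, inner_neg_right, real_inner_smul_right]
    nlinarith

/-- **Short bonds do not cross.** Under (13) with `0 < α ≤ 1/200`, two short bonds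
`{b, c}, {b′, c′} ∈ 𝒮(y)` with four distinct endpoints are disjoint as segments
`[y(b), y(c)] ∩ [y(b′), y(c′)] = ∅` — the planarity of the bond graph implicit in Definition 4.4
("`∂Ω(γ) = ∪_k [y(γ(k)), y(γ(k+1))]` whose existence is guaranteed by Jordan's curve theorem").
[cite: Theil2006, §4.2 Definition 4.4 (preprint p. 19); §2.2 Lemma 2.2 (13) (p. 6); our lemma] -/
theorem segment_inter_segment_eq_empty (hα : 0 < α) (hα' : α ≤ 1 / 200)
    (hsep : ∀ x x' : X, x ≠ x' → 1 - α < dist (y x) (y x')) {b c b' c' : X}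
    (hbc : IsShortRange α y b c) (hb'c' : IsShortRange α y b' c') (h₁ : b ≠ b') (h₂ : b ≠ c')
    (h₃ : c ≠ b') (h₄ : c ≠ c') :
    segment ℝ (y b) (y c) ∩ segment ℝ (y b') (y c') = ∅ := by
  rw [Set.eq_empty_iff_forall_notMem]
  rintro O ⟨hO, hO'⟩
  obtain ⟨P, hP, Q, hQ, hPQ⟩ :=
    exists_dist_lt_of_mem_segments hα hα' hbc.dist_le hb'c'.dist_le hO hO'
  rcases hP with rfl | rfl <;> rcases hQ with rfl | rfl
  · exact absurd hPQ (not_lt.2 (hsep b b' h₁).le)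
  · exact absurd hPQ (not_lt.2 (hsep b c' h₂).le)
  · exact absurd hPQ (not_lt.2 (hsep c b' h₃).le)
  · exact absurd hPQ (not_lt.2 (hsep c c' h₄).le)

/-- (13) makes `y` injective. [folklore] -/
private theorem injective_of_sep (hα : α < 1)
    (hsep : ∀ x x' : X, x ≠ x' → 1 - α < dist (y x) (y x')) : Function.Injective y := by
  intro x x' h
  by_contra hne
  have := hsep x x' hne
  rw [h, dist_self] at this
  linarith

/-- In a wheel listed from `b = q₀`, a rim particle short-range to `b` is `q₁` or `q₅`.
[cite: Theil2006, §4.2 Lemma 4.7 (preprint p. 20); our lemma] -/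
private theorem CcwNbhd.eq_one_or_eq_five {q₀ b : X} {q : Fin 6 → X} {θ : Fin 6 → ℝ}
    (E : CcwNbhd α y q₀ b q θ) (hα : 0 < α) (hα' : α ≤ 1 / 200) {i : Fin 6}
    (h : IsShortRange α y b (q i)) : i = 1 ∨ i = 5 := by
  by_contra hne
  push Not at hne
  have h0i : (0 : Fin 6) ≠ i := by
    rintro rfl
    rw [E.p_zero] at h
    exact h.ne (by linarith) rfl
  refine E.not_isShortRange_of_not_adj hα hα' h0i ?_ (by rw [E.p_zero]; exact h)
  have h5 : ∀ k : Fin 6, (0 : Fin 6) = k + 1 → k = 5 := by decide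
  rintro (hi | hi)
  · exact hne.1 (by rw [hi]; decide)
  · exact hne.2 (h5 i hi)

/-- **A particle in a closed unit triangle is one of its vertices** (Lemma 4.7's rider
`conv(y(𝒩(x))) ∩ y(X) = y(𝒩(x))` at each vertex, and the wheel of `a`: a common neighbour of
`a, b, c` would be a rim particle of `a` adjacent to both `b` and `c`). Hypotheses: (13),
`0 < α ≤ 1/200`, `{a, b, c}` mutually short-range, `a ∉ ∂X`.
[cite: Theil2006, §4.2 Lemma 4.7 (preprint p. 20); our lemma] -/
theorem mem_of_mem_convexHull_triple (hα : 0 < α) (hα' : α ≤ 1 / 200)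
    (hsep : ∀ x x' : X, x ≠ x' → 1 - α < dist (y x) (y x')) {a b c p : X}
    (hab : IsShortRange α y a b) (hac : IsShortRange α y a c) (hbc : IsShortRange α y b c)
    (ha : a ∉ defectSet α y) (hp : y p ∈ convexHull ℝ ({y a, y b, y c} : Set Plane)) :
    p = a ∨ p = b ∨ p = c := by
  have hα1 : α < 1 := by linarith
  have hinj := injective_of_sep hα1 hsep
  -- `p ∈ 𝒩(v)` for each vertex `v`
  have key : ∀ v : X, ({y a, y b, y c} : Set Plane) ⊆ y '' nbhdSet α y v → p ∈ nbhdSet α y v := by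
    intro v hv
    have h1 : y p ∈ convexHull ℝ (y '' nbhdSet α y v) ∩ Set.range y :=
      ⟨convexHull_mono hv hp, Set.mem_range_self p⟩
    rw [convexHull_image_nbhdSet_inter_range hα hsep v] at h1
    obtain ⟨q, hq, hqp⟩ := h1
    rwa [← hinj hqp]
  have hpa : p ∈ nbhdSet α y a := key a (by
    rintro _ (rfl | rfl | rfl)
    · exact ⟨a, mem_nbhdSet_self a, rfl⟩
    · exact ⟨b, hab.mem_nbhdSet, rfl⟩
    · exact ⟨c, hac.mem_nbhdSet, rfl⟩)
  have hpb : p ∈ nbhdSet α y b := key b (by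
    rintro _ (rfl | rfl | rfl)
    · exact ⟨a, hab.symm.mem_nbhdSet, rfl⟩
    · exact ⟨b, mem_nbhdSet_self b, rfl⟩
    · exact ⟨c, hbc.mem_nbhdSet, rfl⟩)
  have hpc : p ∈ nbhdSet α y c := key c (by
    rintro _ (rfl | rfl | rfl)
    · exact ⟨a, hac.symm.mem_nbhdSet, rfl⟩
    · exact ⟨b, hbc.symm.mem_nbhdSet, rfl⟩
    · exact ⟨c, mem_nbhdSet_self c, rfl⟩)
  rw [mem_nbhdSet_iff] at hpa hpb hpc
  rcases hpa with rfl | hpa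
  · exact Or.inl rfl
  rcases hpb with rfl | hpb
  · exact Or.inr (Or.inl rfl)
  rcases hpc with rfl | hpc
  · exact Or.inr (Or.inr rfl)
  -- `p` is a common neighbour of `a, b, c`: impossible in the wheel of `a`
  exfalso
  obtain ⟨q, θ, E⟩ := exists_ccwNbhd hα hα' hsep ha hab
  obtain ⟨i, rfl⟩ := E.mem_range hac
  obtain ⟨j, rfl⟩ := E.mem_range hpa
  have hi := E.eq_one_or_eq_five hα hα' hbc
  have hj := E.eq_one_or_eq_five hα hα' hpb
  have hij : i ≠ j := fun h => hpc.ne hα1 (by rw [h])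
  refine E.not_isShortRange_of_not_adj hα hα' hij ?_ hpc
  rcases hi with rfl | rfl <;> rcases hj with rfl | rfl
  · exact absurd rfl hij
  · decide
  · decide
  · exact absurd rfl hij

/-- Two short bonds at a common particle pointing along the same ray coincide (by (13)).
[folklore] -/
private theorem eq_of_sameRay (hα : 0 < α) (hα' : α ≤ 1 / 200)
    (hsep : ∀ x x' : X, x ≠ x' → 1 - α < dist (y x) (y x')) {p q q' : X}
    (hq : IsShortRange α y p q) (hq' : IsShortRange α y p q') {μ : ℝ} (hμ : 0 ≤ μ)
    (h : y q' - y p = μ • (y q - y p)) : q = q' := by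
  by_contra hne
  have hfar := hsep q q' hne
  have hd : dist (y q) (y q') = |μ - 1| * ‖y q - y p‖ := by
    rw [dist_comm, dist_eq_norm, show y q' - y q = (y q' - y p) - (y q - y p) by abel, h,
      show μ • (y q - y p) - (y q - y p) = (μ - 1) • (y q - y p) by module, norm_smul,
      Real.norm_eq_abs]
  have h1 : 1 - α ≤ ‖y q - y p‖ := by rw [← dist_eq_norm, dist_comm]; exact hq.le_dist
  have h2 : ‖y q - y p‖ ≤ 1 + α := by rw [← dist_eq_norm, dist_comm]; exact hq.dist_le
  have h3 : 1 - α ≤ μ * ‖y q - y p‖ := by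
    have := hq'.le_dist
    rw [dist_comm, dist_eq_norm, h, norm_smul, Real.norm_eq_abs, abs_of_nonneg hμ] at this
    exact this
  have h4 : μ * ‖y q - y p‖ ≤ 1 + α := by
    have := hq'.dist_le
    rw [dist_comm, dist_eq_norm, h, norm_smul, Real.norm_eq_abs, abs_of_nonneg hμ] at this
    exact this
  have h5 : |μ - 1| * ‖y q - y p‖ ≤ 2 * α := by
    rw [← abs_of_nonneg (norm_nonneg (y q - y p)), ← abs_mul, sub_mul, one_mul]
    exact abs_le.2 ⟨by linarith, by linarith⟩
  rw [hd] at hfar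
  linarith

/-! #### Open triangles -/

/-- `ξ` lies in the open triangle `A, B, C`: `ξ = A + s(B − A) + t(C − A)`, `s, t > 0`,
`s + t < 1`. [folklore] -/
private def InOpenTri (ξ A B C : Plane) : Prop :=
  ∃ s t : ℝ, 0 < s ∧ 0 < t ∧ s + t < 1 ∧ ξ = A + (s • (B - A) + t • (C - A))

/-- Symmetry of the open triangle in its last two vertices. [folklore] -/
private theorem InOpenTri.swap₂₃ {ξ A B C : Plane} (h : InOpenTri ξ A B C) : InOpenTri ξ A C B := by
  obtain ⟨s, t, hs, ht, hst, rfl⟩ := h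
  exact ⟨t, s, ht, hs, by linarith, by rw [add_comm (s • (B - A))]⟩

/-- Symmetry of the open triangle in its first two vertices. [folklore] -/
private theorem InOpenTri.swap₁₂ {ξ A B C : Plane} (h : InOpenTri ξ A B C) : InOpenTri ξ B A C := by
  obtain ⟨s, t, hs, ht, hst, rfl⟩ := h
  exact ⟨1 - s - t, t, by linarith, ht, by linarith, by module⟩

/-- Symmetry: move the last vertex to the front. [folklore] -/
private theorem InOpenTri.rotate {ξ A B C : Plane} (h : InOpenTri ξ A B C) : InOpenTri ξ C A B :=
  h.swap₂₃.swap₁₂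

/-- An open triangle lies in the closed one. [folklore] -/
private theorem InOpenTri.mem_convexHull {ξ A B C : Plane} (h : InOpenTri ξ A B C) :
    ξ ∈ convexHull ℝ ({A, B, C} : Set Plane) := by
  obtain ⟨s, t, hs, ht, hst, rfl⟩ := h
  exact mem_convexHull_triple hs.le ht.le hst.le rfl

/-- Uniqueness of the coefficients along two independent vectors. [folklore] -/
private theorem coeff_unique {u v : Plane} (hD : det₂ u v ≠ 0) {s t s' t' : ℝ}
    (h : s • u + t • v = s' • u + t' • v) : s = s' ∧ t = t' := by
  have h1 := congrArg (fun w => det₂ w v) h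
  have h2 := congrArg (fun w => det₂ u w) h
  simp only [det₂_smul_add_smul_left, det₂_smul_add_smul_right] at h1 h2
  exact ⟨mul_right_cancel₀ hD h1, mul_right_cancel₀ hD h2⟩

/-- A point of the edge `[A, B]` is not in the open triangle `A, B, C`. [folklore] -/
private theorem not_inOpenTri_of_mem_segment {η A B C : Plane} (hD : det₂ (B - A) (C - A) ≠ 0)
    (hη : η ∈ segment ℝ A B) : ¬ InOpenTri η A B C := by
  rintro ⟨s, t, hs, ht, hst, hη'⟩
  obtain ⟨a, b, ha, hb, hab, rfl⟩ := hη
  obtain rfl : a = 1 - b := by linarith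
  have h : b • (B - A) + (0 : ℝ) • (C - A) = s • (B - A) + t • (C - A) := by
    have := hη'
    rw [← sub_eq_iff_eq_add'] at this
    rw [← this]
    module
  have := (coeff_unique hD h).2
  linarith

/-- Moving from a point of the open triangle towards the vertex `A` stays in the open triangle.
[folklore] -/
private theorem InOpenTri.towards_vertex {ξ A B C : Plane} (h : InOpenTri ξ A B C) {τ : ℝ}
    (hτ0 : 0 ≤ τ) (hτ1 : τ < 1) : InOpenTri (ξ + τ • (A - ξ)) A B C := by
  obtain ⟨s, t, hs, ht, hst, rfl⟩ := h
  refine ⟨(1 - τ) * s, (1 - τ) * t, mul_pos (by linarith) hs, mul_pos (by linarith) ht, ?_, ?_⟩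
  · nlinarith
  · module

/-- **Exit point.** The segment from a point `ξ` of the open triangle to a point `P` outside the
closed triangle contains, strictly between, a point of the closed triangle not in the open one.
[folklore] -/
private theorem exists_exit {A B C ξ P : Plane} (hD : det₂ (B - A) (C - A) ≠ 0)
    (hξ : InOpenTri ξ A B C) (hP : P ∉ convexHull ℝ ({A, B, C} : Set Plane)) :
    ∃ τ : ℝ, 0 < τ ∧ τ < 1 ∧ ξ + τ • (P - ξ) ∈ convexHull ℝ ({A, B, C} : Set Plane) ∧
      ¬ InOpenTri (ξ + τ • (P - ξ)) A B C := by
  set H := convexHull ℝ ({A, B, C} : Set Plane) with hH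
  set f : ℝ → Plane := fun τ => ξ + τ • (P - ξ) with hf
  have hfc : Continuous f := by
    simp only [hf]
    fun_prop
  have hHc : IsClosed H :=
    ((Set.toFinite ({A, B, C} : Set Plane)).isCompact_convexHull ℝ).isClosed
  set K : Set ℝ := Icc 0 1 ∩ f ⁻¹' H with hK
  have hKc : IsClosed K := isClosed_Icc.inter (hHc.preimage hfc)
  have h0K : (0 : ℝ) ∈ K := ⟨⟨le_rfl, zero_le_one⟩, by
    show ξ + (0 : ℝ) • (P - ξ) ∈ H
    rw [zero_smul, add_zero]; exact hξ.mem_convexHull⟩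
  have hbdd : BddAbove K := ⟨1, fun τ hτ => hτ.1.2⟩
  set τ₀ := sSup K with hτ₀
  have hτ₀K : τ₀ ∈ K := hKc.csSup_mem ⟨0, h0K⟩ hbdd
  have hτ₀1 : τ₀ < 1 := by
    rcases hτ₀K.1.2.eq_or_lt with h | h
    · exfalso
      have : f τ₀ ∈ H := hτ₀K.2
      rw [h] at this
      simp only [hf, one_smul, add_sub_cancel] at this
      exact hP this
    · exact h
  -- no point of the open triangle is the last point of the segment in `H`
  have hnot : ¬ InOpenTri (f τ₀) A B C := by
    intro hopen
    obtain ⟨s, t, hs, ht, hst, heq⟩ := hopen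
    obtain ⟨ε, hε, hball⟩ := exists_ball_subset_of_interior hs ht hst heq hD
    -- a slightly later parameter is still in `K`
    have hPξ : 0 < ‖P - ξ‖ + 1 := by positivity
    set δ := min ((1 - τ₀) / 2) (ε / (2 * (‖P - ξ‖ + 1))) with hδ
    have hδpos : 0 < δ := lt_min (by linarith) (by positivity)
    have hδ1 : τ₀ + δ ≤ 1 := by
      have := min_le_left ((1 - τ₀) / 2) (ε / (2 * (‖P - ξ‖ + 1)))
      linarith
    have hmem : τ₀ + δ ∈ K := by
      refine ⟨⟨by linarith [hτ₀K.1.1], hδ1⟩, hball ?_⟩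
      rw [mem_ball, dist_eq_norm]
      have : f (τ₀ + δ) - f τ₀ = δ • (P - ξ) := by simp only [hf]; module
      rw [this, norm_smul, Real.norm_eq_abs, abs_of_pos hδpos]
      calc δ * ‖P - ξ‖ ≤ ε / (2 * (‖P - ξ‖ + 1)) * ‖P - ξ‖ := by
            gcongr; exact min_le_right _ _
        _ < ε := by
            rw [div_mul_eq_mul_div, div_lt_iff₀ (by positivity)]
            nlinarith [norm_nonneg (P - ξ)]
    have := le_csSup hbdd hmem
    linarith
  have hτ₀0 : 0 < τ₀ := by
    rcases hτ₀K.1.1.eq_or_lt with h | h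
    · exfalso
      apply hnot
      rw [← h]
      simp only [hf, zero_smul, add_zero]
      exact hξ
    · exact h
  exact ⟨τ₀, hτ₀0, hτ₀1, hτ₀K.2, hnot⟩

/-- A point of the closed triangle outside the open one lies on one of the three edges.
[folklore] -/
private theorem exists_mem_segment_of_not_inOpenTri {η A B C : Plane}
    (hη : η ∈ convexHull ℝ ({A, B, C} : Set Plane)) (hno : ¬ InOpenTri η A B C) :
    η ∈ segment ℝ A B ∨ η ∈ segment ℝ A C ∨ η ∈ segment ℝ B C := by
  obtain ⟨a, b, c, ha, hb, hc, habc, rfl⟩ := exists_barycentric hη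
  rcases hc.eq_or_lt with rfl | hc'
  · left
    exact ⟨a, b, ha, hb, by linarith, by simp⟩
  rcases hb.eq_or_lt with rfl | hb'
  · right; left
    exact ⟨a, c, ha, hc, by linarith, by simp⟩
  rcases ha.eq_or_lt with rfl | ha'
  · right; right
    exact ⟨b, c, hb, hc, by linarith, by simp⟩
  exact absurd ⟨b, c, hb', hc', by linarith, by rw [show a = 1 - b - c by linarith]; module⟩ hno

/-- The heart of the non-overlapping argument.  `η` lies on the bond segment `[y p, y q]` of a
unit triangle and in the open triangle of another unit simplex `{a′, b′, c′}`, with `q` not a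
vertex of the latter: contradiction (follow the segment towards `y q`, which leaves the second
triangle through one of its bonds — crossing bonds or two bonds at `p` along one ray).
[cite: Theil2006, §4.2 Definition 4.4, Lemma 4.7 (preprint pp. 19–20); our lemma] -/
private theorem false_of_mem_segment_of_inOpenTri (hα : 0 < α) (hα' : α ≤ 1 / 200)
    (hsep : ∀ x x' : X, x ≠ x' → 1 - α < dist (y x) (y x')) {p q a' b' c' : X}
    (hpq : IsShortRange α y p q) (ha'b' : IsShortRange α y a' b')
    (ha'c' : IsShortRange α y a' c') (hb'c' : IsShortRange α y b' c') (ha' : a' ∉ defectSet α y)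
    (hqa : q ≠ a') (hqb : q ≠ b') (hqc : q ≠ c') {η : Plane} (hη : η ∈ segment ℝ (y p) (y q))
    (hη' : InOpenTri η (y a') (y b') (y c')) : False := by
  have hα1 : α < 1 := by linarith
  have hD' : det₂ (y b' - y a') (y c' - y a') ≠ 0 := fun h0 => by
    have := sq_le_det₂_sq_of_isShortRange hα hα' ha'b' ha'c' hb'c'
    rw [h0] at this; norm_num at this
  -- `y q` is outside the closed triangle `S′`
  have hqout : y q ∉ convexHull ℝ ({y a', y b', y c'} : Set Plane) := fun h => by
    rcases mem_of_mem_convexHull_triple hα hα' hsep ha'b' ha'c' hb'c' ha' h with h | h | h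
    · exact hqa h
    · exact hqb h
    · exact hqc h
  -- exit point `ζ` of `[η, y q]` from `S′`
  obtain ⟨τ, hτ0, hτ1, hζ, hζno⟩ := exists_exit hD' hη' hqout
  set ζ := η + τ • (y q - η) with hζdef
  -- `ζ = y p + κ (y q − y p)` with `0 < κ ≤ 1`, in particular `ζ ∈ [y p, y q]`
  obtain ⟨a, σ, ha, hσ, haσ, hηeq⟩ := hη
  obtain rfl : a = 1 - σ := by linarith
  have hζeq : ζ = y p + (σ + τ * (1 - σ)) • (y q - y p) := by
    rw [hζdef, ← hηeq]; module
  have hκ0 : 0 < σ + τ * (1 - σ) := by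
    rcases hσ.eq_or_lt with rfl | hσ'
    · simpa using hτ0
    · have : 0 ≤ τ * (1 - σ) := mul_nonneg hτ0.le (by linarith)
      linarith
  have hκ1 : σ + τ * (1 - σ) ≤ 1 := by nlinarith
  have hζseg : ζ ∈ segment ℝ (y p) (y q) :=
    ⟨1 - (σ + τ * (1 - σ)), σ + τ * (1 - σ), by linarith, hκ0.le, by ring, by rw [hζeq]; module⟩
  -- `ζ` lies on a bond of `S′`
  have main : ∀ p' q' : X, IsShortRange α y p' q' → (p' = a' ∨ p' = b' ∨ p' = c') →
      (q' = a' ∨ q' = b' ∨ q' = c') → ζ ∈ segment ℝ (y p') (y q') → False := by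
    intro p' q' hp'q' hp' hq' hζ'
    have hqp' : q ≠ p' := by rcases hp' with rfl | rfl | rfl <;> assumption
    have hqq' : q ≠ q' := by rcases hq' with rfl | rfl | rfl <;> assumption
    by_cases hpp' : p = p'
    · -- two bonds at `p` along one ray: `q = q′ ∈ S′`
      subst hpp'
      obtain ⟨a₁, κ', ha₁, hκ', haκ, hζ'eq⟩ := hζ'
      obtain rfl : a₁ = 1 - κ' := by linarith
      have hκ'0 : κ' ≠ 0 := by
        rintro rfl
        have h0 : (σ + τ * (1 - σ)) • (y q - y p) = 0 := by
          have := hζ'eq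
          rw [hζeq] at this
          have h' : y p + (σ + τ * (1 - σ)) • (y q - y p) = y p := by rw [← this]; module
          simpa using h'
        rcases smul_eq_zero.1 h0 with h | h
        · linarith
        · exact hpq.ne hα1 (by rw [sub_eq_zero] at h; exact (injective_of_sep hα1 hsep) h.symm)
      have hray : y q' - y p = ((σ + τ * (1 - σ)) / κ') • (y q - y p) := by
        have h1 : κ' • (y q' - y p) = (σ + τ * (1 - σ)) • (y q - y p) := by
          have := hζ'eq
          rw [hζeq] at this
          have h' : (1 - κ') • y p + κ' • y q' - y p = (σ + τ * (1 - σ)) • (y q - y p) := by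
            rw [this]; module
          rw [← h']; module
        rw [div_eq_mul_inv, mul_comm, mul_smul, ← h1, smul_smul, inv_mul_cancel₀ hκ'0, one_smul]
      have := eq_of_sameRay hα hα' hsep hpq hp'q' (div_nonneg hκ0.le hκ') hray
      exact hqq' this
    by_cases hpq'' : p = q'
    · -- two bonds at `p` along one ray: `q = p′ ∈ S′`
      subst hpq''
      obtain ⟨κ', a₁, hκ', ha₁, haκ, hζ'eq⟩ := hζ'
      obtain rfl : a₁ = 1 - κ' := by linarith
      have hκ'0 : κ' ≠ 0 := by
        rintro rfl
        have h0 : (σ + τ * (1 - σ)) • (y q - y p) = 0 := by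
          have := hζ'eq
          rw [hζeq] at this
          have h' : y p + (σ + τ * (1 - σ)) • (y q - y p) = y p := by rw [← this]; module
          simpa using h'
        rcases smul_eq_zero.1 h0 with h | h
        · linarith
        · exact hpq.ne hα1 (by rw [sub_eq_zero] at h; exact (injective_of_sep hα1 hsep) h.symm)
      have hray : y p' - y p = ((σ + τ * (1 - σ)) / κ') • (y q - y p) := by
        have h1 : κ' • (y p' - y p) = (σ + τ * (1 - σ)) • (y q - y p) := by
          have := hζ'eq
          rw [hζeq] at this
          have h' : κ' • y p' + (1 - κ') • y p - y p = (σ + τ * (1 - σ)) • (y q - y p) := by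
            rw [this]; module
          rw [← h']; module
        rw [div_eq_mul_inv, mul_comm, mul_smul, ← h1, smul_smul, inv_mul_cancel₀ hκ'0, one_smul]
      have := eq_of_sameRay hα hα' hsep hpq hp'q'.symm (div_nonneg hκ0.le hκ') hray
      exact hqp' this
    -- four distinct endpoints: the bonds would cross
    have hempty := segment_inter_segment_eq_empty hα hα' hsep hpq hp'q' hpp' hpq'' hqp' hqq'
    exact (Set.eq_empty_iff_forall_notMem.1 hempty) ζ ⟨hζseg, hζ'⟩
  rcases exists_mem_segment_of_not_inOpenTri hζ hζno with h | h | h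
  · exact main a' b' ha'b' (Or.inl rfl) (Or.inr (Or.inl rfl)) h
  · exact main a' c' ha'c' (Or.inl rfl) (Or.inr (Or.inr rfl)) h
  · exact main b' c' hb'c' (Or.inr (Or.inl rfl)) (Or.inr (Or.inr rfl)) h

/-- One step up: `η` on the bond `[y p, y q]` of a unit simplex and in the open triangle of the
unit simplex `{a′, b′, c′}` is impossible as soon as `{p, q}` is not a bond of the latter.
[cite: Theil2006, §4.2 Definition 4.4, Lemma 4.7 (preprint pp. 19–20); our lemma] -/
private theorem false_of_mem_segment_of_inOpenTri' (hα : 0 < α) (hα' : α ≤ 1 / 200)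
    (hsep : ∀ x x' : X, x ≠ x' → 1 - α < dist (y x) (y x')) {p q a' b' c' : X}
    (hpq : IsShortRange α y p q) (ha'b' : IsShortRange α y a' b')
    (ha'c' : IsShortRange α y a' c') (hb'c' : IsShortRange α y b' c') (ha' : a' ∉ defectSet α y)
    (hnot : ¬ ((p = a' ∨ p = b' ∨ p = c') ∧ (q = a' ∨ q = b' ∨ q = c'))) {η : Plane}
    (hη : η ∈ segment ℝ (y p) (y q)) (hη' : InOpenTri η (y a') (y b') (y c')) : False := by
  by_cases hq : q = a' ∨ q = b' ∨ q = c'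
  · have hp : ¬ (p = a' ∨ p = b' ∨ p = c') := fun h => hnot ⟨h, hq⟩
    push Not at hp
    rw [segment_symm] at hη
    exact false_of_mem_segment_of_inOpenTri hα hα' hsep hpq.symm ha'b' ha'c' hb'c' ha' hp.1 hp.2.1
      hp.2.2 hη hη'
  · push Not at hq
    exact false_of_mem_segment_of_inOpenTri hα hα' hsep hpq ha'b' ha'c' hb'c' ha' hq.1 hq.2.1
      hq.2.2 hη hη'

/-- **Distinct unit simplices do not overlap.** Under (13) with `0 < α ≤ 1/200`, if
`{a, b, c}` and `{a′, b′, c′}` are unit simplices of `y` (three particles, all pairs short-range)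
with `a, a′ ∉ ∂X`, and some vertex `c′` of the second is not a vertex of the first, then the two
OPEN triangles are disjoint. [cite: Theil2006, §4.2 Lemma 4.7 with Definition 4.4 (preprint
pp. 19–20); Appendix proof of Proposition 2.9 (27), partition identity (p. 25); our lemma] -/
theorem not_inOpenTri_of_inOpenTri (hα : 0 < α) (hα' : α ≤ 1 / 200)
    (hsep : ∀ x x' : X, x ≠ x' → 1 - α < dist (y x) (y x')) {a b c a' b' c' : X}
    (hab : IsShortRange α y a b) (hac : IsShortRange α y a c) (hbc : IsShortRange α y b c)
    (ha'b' : IsShortRange α y a' b') (ha'c' : IsShortRange α y a' c')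
    (hb'c' : IsShortRange α y b' c') (ha : a ∉ defectSet α y) (ha' : a' ∉ defectSet α y)
    (hc'a : c' ≠ a) (hc'b : c' ≠ b) (hc'c : c' ≠ c) {ξ : Plane}
    (hξ : ∃ s t : ℝ, 0 < s ∧ 0 < t ∧ s + t < 1 ∧ ξ = y a + (s • (y b - y a) + t • (y c - y a)))
    (hξ' : ∃ s t : ℝ, 0 < s ∧ 0 < t ∧ s + t < 1 ∧
      ξ = y a' + (s • (y b' - y a') + t • (y c' - y a'))) : False := by
  change InOpenTri ξ (y a) (y b) (y c) at hξ
  change InOpenTri ξ (y a') (y b') (y c') at hξ'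
  have hα1 : α < 1 := by linarith
  have hD : det₂ (y b - y a) (y c - y a) ≠ 0 := fun h0 => by
    have := sq_le_det₂_sq_of_isShortRange hα hα' hab hac hbc
    rw [h0] at this; norm_num at this
  -- `y c′` is outside the closed triangle `S`
  have hout : y c' ∉ convexHull ℝ ({y a, y b, y c} : Set Plane) := fun h => by
    rcases mem_of_mem_convexHull_triple hα hα' hsep hab hac hbc ha h with h | h | h
    · exact hc'a h
    · exact hc'b h
    · exact hc'c h
  -- exit point `η` of `[ξ, y c′]` from `S`: on a bond of `S`, inside the open triangle `S′`
  obtain ⟨τ, hτ0, hτ1, hη, hηno⟩ := exists_exit hD hξ hout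
  have hη' : InOpenTri (ξ + τ • (y c' - ξ)) (y a') (y b') (y c') :=
    (hξ'.rotate.towards_vertex hτ0.le hτ1).rotate.rotate
  -- the bond of `S` through `η` is not a bond of `S′` (else `η` would be on the boundary of `S′`)
  have hD' : det₂ (y b' - y a') (y c' - y a') ≠ 0 := fun h0 => by
    have := sq_le_det₂_sq_of_isShortRange hα hα' ha'b' ha'c' hb'c'
    rw [h0] at this; norm_num at this
  have edge : ∀ p q : X, IsShortRange α y p q → ξ + τ • (y c' - ξ) ∈ segment ℝ (y p) (y q) →
      ¬ ((p = a' ∨ p = b' ∨ p = c') ∧ (q = a' ∨ q = b' ∨ q = c')) := by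
    rintro p q hpq hseg ⟨hp, hq⟩
    have hne : p ≠ q := hpq.ne hα1
    -- `η` on a bond of `S′` contradicts `η` in the open triangle of `S′`
    have key : ∀ {P Q R : Plane}, InOpenTri (ξ + τ • (y c' - ξ)) P Q R →
        det₂ (Q - P) (R - P) ≠ 0 → ξ + τ • (y c' - ξ) ∈ segment ℝ P Q → False :=
      fun h hd hs => not_inOpenTri_of_mem_segment hd hs h
    have hDba : det₂ (y a' - y b') (y c' - y b') ≠ 0 := by
      rw [det₂_flip_base]; exact neg_ne_zero.2 hD'
    have hDca : det₂ (y c' - y a') (y b' - y a') ≠ 0 := by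
      rw [det₂_swap']; exact neg_ne_zero.2 hD'
    have hDcb : det₂ (y c' - y b') (y a' - y b') ≠ 0 := by
      rw [det₂_swap']; exact neg_ne_zero.2 hDba
    have hDac : det₂ (y a' - y c') (y b' - y c') ≠ 0 := by
      rw [det₂_flip_base]; exact neg_ne_zero.2 hDca
    have hDbc : det₂ (y b' - y c') (y a' - y c') ≠ 0 := by
      rw [det₂_swap']; exact neg_ne_zero.2 hDac
    rcases hp with rfl | rfl | rfl <;> rcases hq with rfl | rfl | rfl
    · exact hne rfl
    · exact key hη' hD' hseg
    · exact key hη'.swap₂₃ hDca hseg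
    · exact key hη'.swap₁₂ hDba hseg
    · exact hne rfl
    · exact key hη'.swap₁₂.swap₂₃ hDcb hseg
    · exact key hη'.rotate hDac hseg
    · exact key hη'.rotate.swap₂₃ hDbc hseg
    · exact hne rfl
  rcases exists_mem_segment_of_not_inOpenTri hη hηno with h | h | h
  · exact false_of_mem_segment_of_inOpenTri' hα hα' hsep hab ha'b' ha'c' hb'c' ha'
      (edge a b hab h) h hη'
  · exact false_of_mem_segment_of_inOpenTri' hα hα' hsep hac ha'b' ha'c' hb'c' ha'
      (edge a c hac h) h hη'
  · exact false_of_mem_segment_of_inOpenTri' hα hα' hsep hbc ha'b' ha'c' hb'c' ha'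
      (edge b c hbc h) h hη'

end Planarity

/-! ### Two distinct unit simplices meet only in a common face -/

section Faces

variable {X : Type*} {α : ℝ} {y : X → Plane}

/-- A point of a bond segment `[y p′, y q′]` with `p′, q′ ∈ {a, b, c}` is not in the open
triangle of the unit simplex `{a, b, c}`. [folklore] -/
private theorem not_inOpenTri_of_mem_edge (hα : 0 < α) (hα' : α ≤ 1 / 200) {a b c p' q' : X}
    (hab : IsShortRange α y a b) (hac : IsShortRange α y a c) (hbc : IsShortRange α y b c)
    (hp' : p' = a ∨ p' = b ∨ p' = c) (hq' : q' = a ∨ q' = b ∨ q' = c) (hne : p' ≠ q')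
    {ξ : Plane} (hseg : ξ ∈ segment ℝ (y p') (y q')) : ¬ InOpenTri ξ (y a) (y b) (y c) := by
  intro hξ
  have hD : det₂ (y b - y a) (y c - y a) ≠ 0 := fun h0 => by
    have := sq_le_det₂_sq_of_isShortRange hα hα' hab hac hbc
    rw [h0] at this; norm_num at this
  have key : ∀ {P Q R : Plane}, InOpenTri ξ P Q R → det₂ (Q - P) (R - P) ≠ 0 →
      ξ ∈ segment ℝ P Q → False := fun h hd hs => not_inOpenTri_of_mem_segment hd hs h
  have hDba : det₂ (y a - y b) (y c - y b) ≠ 0 := by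
    rw [det₂_flip_base]; exact neg_ne_zero.2 hD
  have hDca : det₂ (y c - y a) (y b - y a) ≠ 0 := by
    rw [det₂_swap']; exact neg_ne_zero.2 hD
  have hDcb : det₂ (y c - y b) (y a - y b) ≠ 0 := by
    rw [det₂_swap']; exact neg_ne_zero.2 hDba
  have hDac : det₂ (y a - y c) (y b - y c) ≠ 0 := by
    rw [det₂_flip_base]; exact neg_ne_zero.2 hDca
  have hDbc : det₂ (y b - y c) (y a - y c) ≠ 0 := by
    rw [det₂_swap']; exact neg_ne_zero.2 hDac
  rcases hp' with rfl | rfl | rfl <;> rcases hq' with rfl | rfl | rfl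
  · exact hne rfl
  · exact key hξ hD hseg
  · exact key hξ.swap₂₃ hDca hseg
  · exact key hξ.swap₁₂ hDba hseg
  · exact hne rfl
  · exact key hξ.swap₁₂.swap₂₃ hDcb hseg
  · exact key hξ.rotate hDac hseg
  · exact key hξ.rotate.swap₂₃ hDbc hseg
  · exact hne rfl

/-- A point of the open triangle of a unit simplex `{a, b, c}` is not in the closed triangle of a
distinct unit simplex `{a′, b′, c′}` (listed with a vertex `c′ ∉ {a, b, c}` last; `a, a′ ∉ ∂X`).
[cite: Theil2006, §4.2 Lemma 4.7 with Definition 4.4 (preprint pp. 19–20); our lemma] -/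
private theorem false_of_inOpenTri_of_mem_convexHull (hα : 0 < α) (hα' : α ≤ 1 / 200)
    (hsep : ∀ x x' : X, x ≠ x' → 1 - α < dist (y x) (y x')) {a b c a' b' c' : X}
    (hab : IsShortRange α y a b) (hac : IsShortRange α y a c) (hbc : IsShortRange α y b c)
    (ha'b' : IsShortRange α y a' b') (ha'c' : IsShortRange α y a' c')
    (hb'c' : IsShortRange α y b' c') (ha : a ∉ defectSet α y) (ha' : a' ∉ defectSet α y)
    (hc'a : c' ≠ a) (hc'b : c' ≠ b) (hc'c : c' ≠ c) {ξ : Plane}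
    (hξ : InOpenTri ξ (y a) (y b) (y c))
    (hξ' : ξ ∈ convexHull ℝ ({y a', y b', y c'} : Set Plane)) : False := by
  have hα1 : α < 1 := by linarith
  by_cases hopen : InOpenTri ξ (y a') (y b') (y c')
  · exact not_inOpenTri_of_inOpenTri hα hα' hsep hab hac hbc ha'b' ha'c' hb'c' ha ha' hc'a hc'b
      hc'c hξ hopen
  have edge : ∀ p' q' : X, IsShortRange α y p' q' → ξ ∈ segment ℝ (y p') (y q') → False := by
    intro p' q' hp'q' hseg
    by_cases hboth : (p' = a ∨ p' = b ∨ p' = c) ∧ (q' = a ∨ q' = b ∨ q' = c)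
    · exact not_inOpenTri_of_mem_edge hα hα' hab hac hbc hboth.1 hboth.2 (hp'q'.ne hα1) hseg hξ
    · exact false_of_mem_segment_of_inOpenTri' hα hα' hsep hp'q' hab hac hbc ha hboth hseg hξ
  rcases exists_mem_segment_of_not_inOpenTri hξ' hopen with h | h | h
  · exact edge a' b' ha'b' h
  · exact edge a' c' ha'c' h
  · exact edge b' c' hb'c' h

/-- A listing `{a, b, v}` of a three-element finset with a prescribed element last. [folklore] -/
private theorem exists_list_last [DecidableEq X] {S : Finset X} (h3 : S.card = 3) {v : X}
    (hv : v ∈ S) : ∃ a b : X, a ≠ b ∧ a ≠ v ∧ b ≠ v ∧ S = {a, b, v} := by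
  obtain ⟨p, q, r, hpq, hpr, hqr, rfl⟩ := Finset.card_eq_three.1 h3
  simp only [Finset.mem_insert, Finset.mem_singleton] at hv
  rcases hv with rfl | rfl | rfl
  · exact ⟨q, r, hqr, hpq.symm, hpr.symm, by ext; simp; tauto⟩
  · exact ⟨p, r, hpr, hpq, hqr.symm, by ext; simp; tauto⟩
  · exact ⟨p, q, hpq, hpr, hqr, rfl⟩

/-- A common point of the closed triangles of two unit simplices lies on a bond of the first
one, as soon as some vertex of the second is not a vertex of the first. [folklore] -/
private theorem exists_edge_of_mem_inter [DecidableEq X] (hα : 0 < α) (hα' : α ≤ 1 / 200)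
    (hsep : ∀ x x' : X, x ≠ x' → 1 - α < dist (y x) (y x')) {S S' : Finset X}
    (hS : IsEquilateralSimplex α y 1 S) (hS' : IsEquilateralSimplex α y 1 S')
    (hgood : ∀ v ∈ S, v ∉ defectSet α y) (hgood' : ∀ v ∈ S', v ∉ defectSet α y)
    {v : X} (hvS' : v ∈ S') (hvS : v ∉ S) {η : Plane} (hη : η ∈ convexHull ℝ (y '' ↑S))
    (hη' : η ∈ convexHull ℝ (y '' ↑S')) :
    ∃ p q : X, p ∈ S ∧ q ∈ S ∧ p ≠ q ∧ η ∈ segment ℝ (y p) (y q) := by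
  have hα1 : α < 1 := by linarith
  obtain ⟨h3, hSR⟩ := isEquilateralSimplex_one_iff.1 hS
  obtain ⟨h3', hSR'⟩ := isEquilateralSimplex_one_iff.1 hS'
  obtain ⟨a, b, c, hab', hac', hbc', rfl⟩ := Finset.card_eq_three.1 h3
  obtain ⟨a', b', ha'b'ne, ha'v, hb'v, rfl⟩ := exists_list_last h3' hvS'
  have hab : IsShortRange α y a b := hSR a (by simp) b (by simp) hab'
  have hac : IsShortRange α y a c := hSR a (by simp) c (by simp) hac'
  have hbc : IsShortRange α y b c := hSR b (by simp) c (by simp) hbc'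
  have ha'b' : IsShortRange α y a' b' := hSR' a' (by simp) b' (by simp) ha'b'ne
  have ha'c' : IsShortRange α y a' v := hSR' a' (by simp) v (by simp) ha'v
  have hb'c' : IsShortRange α y b' v := hSR' b' (by simp) v (by simp) hb'v
  simp only [Finset.mem_insert, Finset.mem_singleton, not_or] at hvS
  rw [image_coe_triple] at hη hη'
  by_cases hopen : InOpenTri η (y a) (y b) (y c)
  · exact (false_of_inOpenTri_of_mem_convexHull hα hα' hsep hab hac hbc ha'b' ha'c' hb'c'
      (hgood a (by simp)) (hgood' a' (by simp)) hvS.1 hvS.2.1 hvS.2.2 hopen hη').elim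
  rcases exists_mem_segment_of_not_inOpenTri hη hopen with h | h | h
  · exact ⟨a, b, by simp, by simp, hab', h⟩
  · exact ⟨a, c, by simp, by simp, hac', h⟩
  · exact ⟨b, c, by simp, by simp, hbc', h⟩

/-- **Two distinct unit simplices meet only in a common face.** Under (13) with
`0 < α ≤ 1/200`, for unit simplices `S ≠ S′` of `y` (Definition 2.6, `λ = 1`) whose vertices are
not defects, `conv(y(S)) ∩ conv(y(S′)) ⊆ conv(y(S ∩ S′))` — empty, a common vertex, or a common
bond: the unit simplices of the defect-free region form a simplicial complex embedded in the
plane (the structure behind Definition 4.4's bond polygons and the partition of p. 25).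
[cite: Theil2006, §4.2 Lemma 4.7 with Definition 4.4 (preprint pp. 19–20); Appendix proof of
Proposition 2.9 (27) (p. 25); our lemma] -/
theorem convexHull_inter_convexHull_subset_face [DecidableEq X] (hα : 0 < α) (hα' : α ≤ 1 / 200)
    (hsep : ∀ x x' : X, x ≠ x' → 1 - α < dist (y x) (y x')) {S S' : Finset X}
    (hS : IsEquilateralSimplex α y 1 S) (hS' : IsEquilateralSimplex α y 1 S') (hne : S ≠ S')
    (hgood : ∀ v ∈ S, v ∉ defectSet α y) (hgood' : ∀ v ∈ S', v ∉ defectSet α y) :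
    convexHull ℝ (y '' ↑S) ∩ convexHull ℝ (y '' ↑S') ⊆ convexHull ℝ (y '' ↑(S ∩ S')) := by
  have hα1 : α < 1 := by linarith
  rintro η ⟨hη, hη'⟩
  obtain ⟨h3, hSR⟩ := isEquilateralSimplex_one_iff.1 hS
  obtain ⟨h3', hSR'⟩ := isEquilateralSimplex_one_iff.1 hS'
  -- vertices outside the other simplex, on both sides
  obtain ⟨v, hvS', hvS⟩ : ∃ v ∈ S', v ∉ S := by
    by_contra hall
    push Not at hall
    exact hne (Finset.eq_of_subset_of_card_le hall (by rw [h3, h3'])).symm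
  obtain ⟨w, hwS, hwS'⟩ : ∃ w ∈ S, w ∉ S' := by
    by_contra hall
    push Not at hall
    exact hne (Finset.eq_of_subset_of_card_le hall (by rw [h3, h3']))
  -- `η` on a bond of `S` and on a bond of `S′`
  obtain ⟨p, q, hp, hq, hpq, hηpq⟩ :=
    exists_edge_of_mem_inter hα hα' hsep hS hS' hgood hgood' hvS' hvS hη hη'
  obtain ⟨p', q', hp', hq', hp'q', hηp'q'⟩ :=
    exists_edge_of_mem_inter hα hα' hsep hS' hS hgood' hgood hwS hwS' hη' hη
  have hSRpq : IsShortRange α y p q := hSR p hp q hq hpq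
  have hSRp'q' : IsShortRange α y p' q' := hSR' p' hp' q' hq' hp'q'
  -- the two bonds share a particle (otherwise they would cross)
  have hshare : p = p' ∨ p = q' ∨ q = p' ∨ q = q' := by
    by_contra h
    push Not at h
    have hempty := segment_inter_segment_eq_empty hα hα' hsep hSRpq hSRp'q' h.1 h.2.1 h.2.2.1
      h.2.2.2
    exact (Set.eq_empty_iff_forall_notMem.1 hempty) η ⟨hηpq, hηp'q'⟩
  -- normalise to a common first endpoint `p₀` with second endpoints `r ∈ S`, `r′ ∈ S′`
  obtain ⟨p₀, r, r', hp₀S, hp₀S', hrS, hr'S', h0r, h0r', hηr, hηr'⟩ : ∃ p₀ r r' : X,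
      p₀ ∈ S ∧ p₀ ∈ S' ∧ r ∈ S ∧ r' ∈ S' ∧ IsShortRange α y p₀ r ∧ IsShortRange α y p₀ r' ∧
      η ∈ segment ℝ (y p₀) (y r) ∧ η ∈ segment ℝ (y p₀) (y r') := by
    rcases hshare with rfl | rfl | rfl | rfl
    · exact ⟨p, q, q', hp, hp', hq, hq', hSRpq, hSRp'q', hηpq, hηp'q'⟩
    · exact ⟨p, q, p', hp, hq', hq, hp', hSRpq, hSRp'q'.symm, hηpq, by rwa [segment_symm]⟩
    · exact ⟨q, p, q', hq, hp', hp, hq', hSRpq.symm, hSRp'q', by rwa [segment_symm], hηp'q'⟩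
    · exact ⟨q, p, p', hq, hq', hp, hp', hSRpq.symm, hSRp'q'.symm, by rwa [segment_symm],
        by rwa [segment_symm]⟩
  have hp₀ : p₀ ∈ S ∩ S' := Finset.mem_inter.2 ⟨hp₀S, hp₀S'⟩
  -- if `η = y p₀` or `r = r′`, we are on a common face
  by_cases hηp : η = y p₀
  · rw [hηp]
    exact subset_convexHull ℝ _ ⟨p₀, Finset.mem_coe.2 hp₀, rfl⟩
  by_cases hrr' : r = r'
  · subst hrr'
    have hr : r ∈ S ∩ S' := Finset.mem_inter.2 ⟨hrS, hr'S'⟩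
    refine (convex_convexHull ℝ _).segment_subset ?_ ?_ hηr
    · exact subset_convexHull ℝ _ ⟨p₀, Finset.mem_coe.2 hp₀, rfl⟩
    · exact subset_convexHull ℝ _ ⟨r, Finset.mem_coe.2 hr, rfl⟩
  -- otherwise the two bonds at `p₀` point along one ray: contradiction with (13)
  exfalso
  obtain ⟨a₁, κ, ha₁, hκ, haκ, hηeq⟩ := hηr
  obtain rfl : a₁ = 1 - κ := by linarith
  obtain ⟨a₂, κ', ha₂, hκ', haκ', hηeq'⟩ := hηr'
  obtain rfl : a₂ = 1 - κ' := by linarith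
  have hκ'0 : κ' ≠ 0 := by
    rintro rfl
    apply hηp
    rw [← hηeq']; module
  have h1 : κ • (y r - y p₀) = κ' • (y r' - y p₀) := by
    have e1 : κ • (y r - y p₀) = η - y p₀ := by rw [← hηeq]; module
    have e2 : κ' • (y r' - y p₀) = η - y p₀ := by rw [← hηeq']; module
    rw [e1, e2]
  have hray : y r' - y p₀ = (κ / κ') • (y r - y p₀) := by
    rw [div_eq_mul_inv, mul_comm, mul_smul, h1, smul_smul, inv_mul_cancel₀ hκ'0, one_smul]
  exact hrr' (eq_of_sameRay hα hα' hsep h0r h0r' (div_nonneg hκ hκ') hray)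

end Faces

/-! ### The partition of a long simplex by the unit simplices (Appendix p. 25) -/

section Partition

open MeasureTheory

variable {X : Type*} {α : ℝ} {y : X → Plane}

/-- A segment of the plane is Lebesgue-null. [folklore] -/
private theorem volume_segment (A B : Plane) : volume (segment ℝ A B) = 0 := by
  have h : segment ℝ A B ⊆ (fun v => A + v) '' (Submodule.span ℝ {B - A} : Set Plane) := by
    rintro _ ⟨a, b, ha, hb, hab, rfl⟩
    refine ⟨b • (B - A), Submodule.smul_mem _ _ (Submodule.subset_span rfl), ?_⟩
    obtain rfl : a = 1 - b := by linarith
    show A + b • (B - A) = (1 - b) • A + b • B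
    module
  refine measure_mono_null h ?_
  rw [Set.image_add_left, measure_preimage_add]
  refine Measure.addHaar_submodule volume _ fun htop => ?_
  have h1 : Module.finrank ℝ (Submodule.span ℝ (({B - A} : Finset Plane) : Set Plane)) ≤ 1 :=
    (finrank_span_finset_le_card _).trans (by simp)
  rw [Finset.coe_singleton, htop, finrank_top, finrank_euclideanSpace_fin] at h1
  omega

/-- A point of a closed triangle off its three edges lies in the open triangle. [folklore] -/
private theorem inOpenTri_of_not_mem_segments {η A B C : Plane}
    (hη : η ∈ convexHull ℝ ({A, B, C} : Set Plane))
    (h : η ∉ segment ℝ A B ∪ segment ℝ A C ∪ segment ℝ B C) : InOpenTri η A B C := by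
  by_contra hno
  rcases exists_mem_segment_of_not_inOpenTri hη hno with h' | h' | h'
  · exact h (Or.inl (Or.inl h'))
  · exact h (Or.inl (Or.inr h'))
  · exact h (Or.inr h')

/-- **Distinct unit simplices overlap in a null set.** Under (13) with `0 < α ≤ 1/200`, for unit
simplices `S ≠ S′` of `y` whose vertices are not defects, `conv(y(S)) ∩ conv(y(S′))` is
Lebesgue-null (it lies on the six edges). [cite: Theil2006, Appendix proof of Proposition 2.9
(27), partition identity (preprint p. 25); §4.2 Lemma 4.7 (p. 20); our lemma] -/
theorem volume_convexHull_inter_convexHull_eq_zero (hα : 0 < α) (hα' : α ≤ 1 / 200)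
    (hsep : ∀ x x' : X, x ≠ x' → 1 - α < dist (y x) (y x')) {S S' : Finset X}
    (hS : IsEquilateralSimplex α y 1 S) (hS' : IsEquilateralSimplex α y 1 S') (hne : S ≠ S')
    (hgood : ∀ v ∈ S, v ∉ defectSet α y) (hgood' : ∀ v ∈ S', v ∉ defectSet α y) :
    volume (convexHull ℝ (y '' ↑S) ∩ convexHull ℝ (y '' ↑S')) = 0 := by
  classical
  have hα1 : α < 1 := by linarith
  obtain ⟨h3, hSR⟩ := isEquilateralSimplex_one_iff.1 hS
  obtain ⟨h3', hSR'⟩ := isEquilateralSimplex_one_iff.1 hS'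
  -- a vertex of `S′` outside `S`, listed last
  obtain ⟨v, hvS', hvS⟩ : ∃ v ∈ S', v ∉ S := by
    by_contra hall
    push Not at hall
    exact hne (Finset.eq_of_subset_of_card_le hall (by rw [h3, h3'])).symm
  obtain ⟨a, b, c, hab', hac', hbc', rfl⟩ := Finset.card_eq_three.1 h3
  have hab : IsShortRange α y a b := hSR a (by simp) b (by simp) hab'
  have hac : IsShortRange α y a c := hSR a (by simp) c (by simp) hac'
  have hbc : IsShortRange α y b c := hSR b (by simp) c (by simp) hbc'
  -- enumerate `S′ = {a′, b′, c′}` with `c′ = v`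
  obtain ⟨a', b', c', ha'b'ne, ha'c'ne, hb'c'ne, hS'eq, hc'v⟩ : ∃ a' b' c' : X, a' ≠ b' ∧ a' ≠ c' ∧
      b' ≠ c' ∧ S' = {a', b', c'} ∧ c' = v := by
    obtain ⟨p, q, r, hpq, hpr, hqr, rfl⟩ := Finset.card_eq_three.1 h3'
    simp only [Finset.mem_insert, Finset.mem_singleton] at hvS'
    rcases hvS' with rfl | rfl | rfl
    · exact ⟨q, r, v, hqr, hpq.symm, hpr.symm, by ext; simp; tauto, rfl⟩
    · exact ⟨p, r, v, hpr, hpq, hqr.symm, by ext; simp; tauto, rfl⟩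
    · exact ⟨p, q, v, hpq, hpr, hqr, rfl, rfl⟩
  subst hc'v
  rw [hS'eq] at hSR' hgood' ⊢
  have ha'b' : IsShortRange α y a' b' := hSR' a' (by simp) b' (by simp) ha'b'ne
  have ha'c' : IsShortRange α y a' c' := hSR' a' (by simp) c' (by simp) ha'c'ne
  have hb'c' : IsShortRange α y b' c' := hSR' b' (by simp) c' (by simp) hb'c'ne
  simp only [Finset.mem_insert, Finset.mem_singleton, not_or] at hvS
  obtain ⟨hc'a, hc'b, hc'c⟩ := hvS
  -- the overlap lies on the six edges
  set E : Set Plane := (segment ℝ (y a) (y b) ∪ segment ℝ (y a) (y c) ∪ segment ℝ (y b) (y c)) ∪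
    (segment ℝ (y a') (y b') ∪ segment ℝ (y a') (y c') ∪ segment ℝ (y b') (y c')) with hE
  have hsub : convexHull ℝ (y '' ↑({a, b, c} : Finset X)) ∩
      convexHull ℝ (y '' ↑({a', b', c'} : Finset X)) ⊆ E := by
    rintro η ⟨hη, hη'⟩
    rw [image_coe_triple] at hη hη'
    by_contra hηE
    rw [hE, Set.mem_union, not_or] at hηE
    have h1 := inOpenTri_of_not_mem_segments hη hηE.1
    have h2 := inOpenTri_of_not_mem_segments hη' hηE.2
    exact not_inOpenTri_of_inOpenTri hα hα' hsep hab hac hbc ha'b' ha'c' hb'c'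
      (hgood a (by simp)) (hgood' a' (by simp)) hc'a hc'b hc'c h1 h2
  refine measure_mono_null hsub ?_
  rw [hE]
  simp only [measure_union_null_iff, volume_segment, and_self]

/-- **The partition identity of the proof of Proposition 2.9 (27)** (Appendix p. 25, the step
"`Σ_T meas(conv(y(T))) = Σ_T Σ_{S∈𝒯₁} meas(conv(y(S)) ∩ conv(y(T)))` (Lemma 2.7)"), proved for
each long simplex: under (13) with `0 < α ≤ 1/200` and finitely many particles, for
`T ∈ 𝒯_λ(y)` with `λ > 1`, `meas(conv y(T)) = Σ_{S ∈ 𝒯₁(y)} meas(conv y(S) ∩ conv y(T))` — the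
unit simplices cover `conv y(T)` ((63), `IsEquilateralSimplex.convexHull_subset_biUnion`) and
overlap in null sets (`volume_convexHull_inter_convexHull_eq_zero`).
[cite: Theil2006, Appendix proof of Proposition 2.9 (27) (preprint p. 25)] -/
theorem volume_convexHull_eq_sum_inter [Fintype X] [DecidablePred fun S : Finset X =>
      IsEquilateralSimplex α y 1 S] (hα : 0 < α) (hα' : α ≤ 1 / 200)
    (hsep : ∀ x x' : X, x ≠ x' → 1 - α < dist (y x) (y x')) {lam : ℝ} {T : Finset X}
    (hT : IsEquilateralSimplex α y lam T) (hlam : 1 < lam) :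
    volume (convexHull ℝ (y '' ↑T)) =
      ∑ S ∈ Finset.univ.filter (fun S : Finset X => IsEquilateralSimplex α y 1 S),
        volume (convexHull ℝ (y '' ↑S) ∩ convexHull ℝ (y '' ↑T)) := by
  classical
  have hα1 : α < 1 := by linarith
  set 𝒰 := Finset.univ.filter (fun S : Finset X => IsEquilateralSimplex α y 1 S) with h𝒰
  have hcover := hT.convexHull_subset_biUnion hα hα' hsep hlam
  -- `conv y(T)` is the union of its pieces
  have hunion : convexHull ℝ (y '' ↑T) =
      ⋃ S ∈ 𝒰, convexHull ℝ (y '' ↑S) ∩ convexHull ℝ (y '' ↑T) := by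
    apply Set.Subset.antisymm
    · intro η hη
      obtain ⟨S, hS, hηS⟩ := mem_iUnion₂.1 (hcover hη)
      exact mem_iUnion₂.2 ⟨S, by rw [h𝒰, Finset.mem_filter]; exact ⟨Finset.mem_univ _, hS.1⟩,
        hηS, hη⟩
    · intro η hη
      obtain ⟨S, -, hηS⟩ := mem_iUnion₂.1 hη
      exact hηS.2
  -- facts about `T`
  rcases hT.2 with ⟨h1, -⟩ | ⟨-, hfar, ω, Φ, -, hTω, -, -, hω5, -⟩
  · exact absurd h1 (ne_of_gt hlam)
  set z := simplexCentre y T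
  have hTball : convexHull ℝ (y '' ↑T) ⊆ ball z (6 * lam) := by
    refine convexHull_min ?_ (convex_ball z (6 * lam))
    rintro _ ⟨x, hx, rfl⟩
    have h5 : y x ∈ closedBall z (5 * lam) := hω5 ⟨x, hTω hx, rfl⟩
    rw [mem_closedBall] at h5
    rw [mem_ball]
    linarith
  -- a unit simplex meeting `conv y(T)` has no defect vertex
  have hgood : ∀ S : Finset X, IsEquilateralSimplex α y 1 S →
      (convexHull ℝ (y '' ↑S) ∩ convexHull ℝ (y '' ↑T)).Nonempty → ∀ v ∈ S, v ∉ defectSet α y := by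
    intro S hS hne v hv hvdef
    obtain ⟨η, hηS, hηT⟩ := hne
    obtain ⟨h3, hSR⟩ := isEquilateralSimplex_one_iff.1 hS
    obtain ⟨a, b, c, hab, hac, hbc, rfl⟩ := Finset.card_eq_three.1 h3
    rw [image_coe_triple] at hηS
    have hab' := hSR a (by simp) b (by simp) hab
    have hac' := hSR a (by simp) c (by simp) hac
    have hbc' := hSR b (by simp) c (by simp) hbc
    have hd : dist (y v) η ≤ 1 + α := by
      rw [dist_comm]
      simp only [Finset.mem_insert, Finset.mem_singleton] at hv
      rcases hv with rfl | rfl | rfl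
      · exact dist_le_of_mem_convexHull_triple (by rw [dist_self]; linarith)
          (by rw [dist_comm]; exact hab'.dist_le) (by rw [dist_comm]; exact hac'.dist_le) hηS
      · exact dist_le_of_mem_convexHull_triple hab'.dist_le (by rw [dist_self]; linarith)
          (by rw [dist_comm]; exact hbc'.dist_le) hηS
      · exact dist_le_of_mem_convexHull_triple hac'.dist_le hbc'.dist_le
          (by rw [dist_self]; linarith) hηS
    have h1 := hfar v hvdef
    have h2 := mem_ball.1 (hTball hηT)
    have h3 : dist (y v) z ≤ dist (y v) η + dist η z := dist_triangle _ _ _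
    linarith
  have hμ : volume (convexHull ℝ (y '' ↑T)) =
      volume (⋃ S ∈ 𝒰, convexHull ℝ (y '' ↑S) ∩ convexHull ℝ (y '' ↑T)) := by rw [← hunion]
  rw [hμ]
  refine measure_biUnion_finset₀ ?_ fun S _ => ?_
  · intro S hS S' hS' hne
    have hS1 : IsEquilateralSimplex α y 1 S := by
      rw [Finset.mem_coe, h𝒰, Finset.mem_filter] at hS; exact hS.2
    have hS'1 : IsEquilateralSimplex α y 1 S' := by
      rw [Finset.mem_coe, h𝒰, Finset.mem_filter] at hS'; exact hS'.2
    change volume ((convexHull ℝ (y '' ↑S) ∩ convexHull ℝ (y '' ↑T)) ∩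
      (convexHull ℝ (y '' ↑S') ∩ convexHull ℝ (y '' ↑T))) = 0
    by_cases hSe : (convexHull ℝ (y '' ↑S) ∩ convexHull ℝ (y '' ↑T)).Nonempty
    · by_cases hS'e : (convexHull ℝ (y '' ↑S') ∩ convexHull ℝ (y '' ↑T)).Nonempty
      · refine measure_mono_null (t := convexHull ℝ (y '' ↑S) ∩ convexHull ℝ (y '' ↑S'))
          (fun η hη => ⟨hη.1.1, hη.2.1⟩) ?_
        exact volume_convexHull_inter_convexHull_eq_zero hα hα' hsep hS1 hS'1 hne
          (hgood S hS1 hSe) (hgood S' hS'1 hS'e)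
      · rw [Set.not_nonempty_iff_eq_empty] at hS'e
        rw [hS'e, Set.inter_empty, measure_empty]
    · rw [Set.not_nonempty_iff_eq_empty] at hSe
      rw [hSe, Set.empty_inter, measure_empty]
  · exact ((((S.finite_toSet.image y).isCompact_convexHull ℝ).isClosed).inter
      (((T.finite_toSet.image y).isCompact_convexHull ℝ).isClosed)).measurableSet.nullMeasurableSet

/-- The partition identity in real numbers (all the volumes are finite).
[cite: Theil2006, Appendix proof of Proposition 2.9 (27) (preprint p. 25)] -/
theorem toReal_volume_convexHull_eq_sum_inter [Fintype X] [DecidablePred fun S : Finset X =>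
      IsEquilateralSimplex α y 1 S] (hα : 0 < α) (hα' : α ≤ 1 / 200)
    (hsep : ∀ x x' : X, x ≠ x' → 1 - α < dist (y x) (y x')) {lam : ℝ} {T : Finset X}
    (hT : IsEquilateralSimplex α y lam T) (hlam : 1 < lam) :
    (volume (convexHull ℝ (y '' ↑T))).toReal =
      ∑ S ∈ Finset.univ.filter (fun S : Finset X => IsEquilateralSimplex α y 1 S),
        (volume (convexHull ℝ (y '' ↑S) ∩ convexHull ℝ (y '' ↑T))).toReal := by
  rw [volume_convexHull_eq_sum_inter hα hα' hsep hT hlam, ENNReal.toReal_sum]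
  intro S _
  exact (lt_of_le_of_lt (measure_mono Set.inter_subset_right)
    ((T.finite_toSet.image y).isCompact_convexHull ℝ).measure_lt_top).ne

end Partition

end Theil2006

end Literature.MathematicalPhysics.StatisticalMechanics
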